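import Literature.Topology.FourManifolds.SmoothClamp
import HarnessLib

/-!
# The lower track of the slid attaching circle in band coordinates ("K2-lite"), height-driven form

Topic `Literature/Topology/FourManifolds`; fact seat `provefact-IsStrictHandleSlide.isSurgery`
(R. C. Kirby, *The Topology of 4-Manifolds*, LNM 1374 (1989), Ch. I §4; remaining content: the
named fact (S) `Literature.Topology.FourManifolds.FramedLink.IsStrictHandleSlide.slideModel`).
The slid circle `K₂` (the attaching circle after the handle slide, before the final
reparametrisation) is obtained from the rebuilt band sum by reshaping its lower (and upper) arch
along an admissible track (`BandCore.exists_ambientIsotopy_lowerTrack'`,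
`SlideReshapeLower2.lean`). This file writes the lower track down **directly in band coordinates**
as two explicit real functions of the arch parameter `τ`, driven by a *virtual height*:

* the virtual height `Hh τ = f τ + c_h · smoothStep (b - ε) (b - ε/2) τ` (the edge height `f`
  lifted by `c_h` during the landing window);
* the abscissa `X₁ τ = smoothMinConst 1 εℓ (Xg τ)`, `Xg τ = ρ̃ (Hh τ) + guard τ`, where
  `ρ̃ h = (1 - κ₀) smoothStep (f a) h_pl h + smoothStep h_r0 h_r1 h` is a **height profile** (the
  rise to the plateau `x₀ = 1 - κ₀`, then the landing step placed in the top of the lift) and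
  `guard = 2 smoothStep (b + ε/2) (b + ε)` only pins the far end; so up to the tip the track is the
  graph `x₀ = ρ₁ h := smoothMinConst 1 εℓ (ρ̃ h)` over the height — exactly the curve the finger
  move of `Kᵢ` produces (`K1Loop.lean`), with no inverse functions;
* the height `H₁ τ = (1 - S₂ τ) · (Hh τ - m_s · ζ (Xg τ - x_D)) + S₂ τ · g τ`: past the tip
  abscissa `x_D = 1 - κ_D` the height is bent down at slope `m_s` (`ζ u = u · smoothStep 0 u₁ u`),
  and finally blended into the descending edge height `g` of the arch
  (`S₂ = smoothStep (1 + κ_D) (1 + 2κ_D) ∘ Xg`).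

The hypotheses of `exists_ambientIsotopy_lowerTrack'` are proved for `(X₁, H₁)` in abstract form:
smoothness, the plateau formulas, `X₁ ∈ [0, 1]` non-decreasing, `X₁ = 0 ⇒ H₁ = f`, `X₁ < 1`
before the landing window, `H₁ ∈ (1/10, 1/2)`, `H₁ ≥ g` where `X₁ = 1`, injectivity, regularity
and the two co-monotonicity clauses with the arch height
`v = (1 - smoothStep (a + ε) (b - ε)) f + smoothStep (a + ε) (b - ε) g`.

* `K2LiteData` (structure) and the namespace `K2LiteData`.

## References

* R. C. Kirby, *The Topology of 4-Manifolds*, LNM 1374, Springer (1989), Ch. I §4. [Kirby1989]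
-/

open scoped ContDiff Topology
open Set Real Filter

noncomputable section

namespace Literature.Topology.FourManifolds

/-- **Data of the band-coordinate lower track.** The abscissa of the arch is
`smoothStep a b`, the half-width of its junction zones is `ε` (the arch has abscissa `0` up to `a`,
`1` from `b`, height `f` up to `a + ε`, height `g` from `b - ε`); the lift `c_h`; the plateau gap
`κ₀` reached at height `h_pl`; the landing step in height `[h_r0, h_r1]`; the tip depth `κ_D`, the
landing width `εℓ`, the bend width `u₁`, the slope `m_s`; a lower bound `vmin` of the abscissa
speed on the landing levels and an upper bound `MH` of `Hh'` on the landing window; height bounds.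
[cite: Kirby1989, Ch. I §4] -/
structure K2LiteData where
  a : ℝ
  b : ℝ
  ε : ℝ
  f : ℝ → ℝ
  g : ℝ → ℝ
  ch : ℝ
  κ₀ : ℝ
  hpl : ℝ
  hr0 : ℝ
  hr1 : ℝ
  κD : ℝ
  εℓ : ℝ
  u₁ : ℝ
  ms : ℝ
  vmin : ℝ
  MH : ℝ
  ε_pos : 0 < ε
  hab : a + ε < b - ε
  f_smooth : ContDiff ℝ ∞ f
  g_smooth : ContDiff ℝ ∞ g
  f_deriv_pos : ∀ t, t ≤ b + ε → 0 < deriv f t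
  g_deriv_neg : ∀ t, b - ε ≤ t → deriv g t < 0
  ch_pos : 0 < ch
  κ₀_pos : 0 < κ₀
  κ₀_le : κ₀ ≤ 2⁻¹
  hpl_gt : f a < hpl
  hpl_le : hpl ≤ hr0
  hr0_gt : f (b - ε) < hr0
  hr_lt : hr0 < hr1
  hr1_le : hr1 ≤ f (b - ε / 2) + ch
  κD_pos : 0 < κD
  /-- The tip, landing and blend levels `κ₀ - 3κ_D, …, κ₀ + 3κ_D` of the landing step are interior. -/
  κD_le : 4 * κD ≤ κ₀
  κD_small : κ₀ + 3 * κD < 1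
  εℓ_pos : 0 < εℓ
  εℓ_le : 4 * εℓ ≤ κD
  u₁_pos : 0 < u₁
  u₁_le : u₁ ≤ κD
  ms_pos : 0 < ms
  vmin_pos : 0 < vmin
  /-- On the landing levels the abscissa speed is at least `vmin` (through the lower bound
  `smoothStep' (Hh) · f'` of `(ρ̃ ∘ Hh)'`). -/
  vmin_le : ∀ t ∈ Icc (b - ε) (b - ε / 2),
    smoothStep hr0 hr1 (f t + ch * smoothStep (b - ε) (b - ε / 2) t) ∈ Icc (κ₀ - 3 * κD) (κ₀ + 3 * κD) →
    vmin ≤ deriv (smoothStep hr0 hr1) (f t + ch * smoothStep (b - ε) (b - ε / 2) t) * deriv f t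
  MH_ge : ∀ t ∈ Icc (b - ε) (b + ε), deriv f t + ch * deriv (smoothStep (b - ε) (b - ε / 2)) t ≤ MH
  ms_large : 2 * MH ≤ ms * vmin
  f_lo : ∀ t ∈ Icc (a - ε / 2) (b + ε), 10⁻¹ < f t
  f_hi : ∀ t ∈ Icc (a - ε / 2) (b + ε), f t + ch < 2⁻¹
  g_mem : ∀ t ∈ Icc (b - ε) (b + ε), g t ∈ Ioo (10⁻¹ : ℝ) 2⁻¹
  /-- The landing heights stay above `g` with the margin `3 m_s κ_D`. -/
  gap : ∀ t ∈ Icc (b - ε) (b + ε), g t + 3 * ms * κD < hr0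

namespace K2LiteData

variable (d : K2LiteData)

/-! ### The definitions -/

/-- The lift step `smoothStep (b - ε) (b - ε/2)`. [folklore] -/
def Slift (t : ℝ) : ℝ := smoothStep (d.b - d.ε) (d.b - d.ε / 2) t

/-- **The virtual height** `Hh = f + c_h · Slift`. [folklore] -/
def Hh (t : ℝ) : ℝ := d.f t + d.ch * d.Slift t

/-- The rise profile in height, `(1 - κ₀) smoothStep (f a) h_pl`. [folklore] -/
def ρrise (h : ℝ) : ℝ := (1 - d.κ₀) * smoothStep (d.f d.a) d.hpl h

/-- The landing step in height, `smoothStep h_r0 h_r1`. [folklore] -/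
def Sr (h : ℝ) : ℝ := smoothStep d.hr0 d.hr1 h

/-- **The height profile of the abscissa**, `ρ̃ = ρrise + Sr`. [folklore] -/
def ρt (h : ℝ) : ℝ := d.ρrise h + d.Sr h

/-- **The height-graph abscissa** `ρ₁ = smoothMinConst 1 εℓ ∘ ρ̃` (values in `[0, 1]`). [folklore] -/
def ρ₁ (h : ℝ) : ℝ := smoothMinConst 1 d.εℓ (d.ρt h)

/-- The far-end guard `2 smoothStep (b + ε/2) (b + ε)` (vanishes up to `b + ε/2`). [folklore] -/
def guard (t : ℝ) : ℝ := 2 * smoothStep (d.b + d.ε / 2) (d.b + d.ε) t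

/-- The raw abscissa `ρ̃ (Hh τ)`. [folklore] -/
def Xl (t : ℝ) : ℝ := d.ρt (d.Hh t)

/-- The guarded raw abscissa `ρ̃ (Hh τ) + guard τ`. [folklore] -/
def Xg (t : ℝ) : ℝ := d.Xl t + d.guard t

/-- **The abscissa of the track**, `smoothMinConst 1 εℓ ∘ Xg`. [folklore] -/
def X₁ (t : ℝ) : ℝ := smoothMinConst 1 d.εℓ (d.Xg t)

/-- The tip abscissa `x_D = 1 - κ_D`. [folklore] -/
def xD : ℝ := 1 - d.κD

/-- The smoothed positive part `ζ u = u · smoothStep 0 u₁ u`. [folklore] -/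
def ζ (u : ℝ) : ℝ := u * smoothStep 0 d.u₁ u

/-- The bent virtual height `Hh - m_s · ζ (Xg - x_D)`. [folklore] -/
def P (t : ℝ) : ℝ := d.Hh t - d.ms * d.ζ (d.Xg t - d.xD)

/-- The final blend parameter `smoothStep (1 + κ_D) (1 + 2κ_D) ∘ Xg`. [folklore] -/
def S₂ (t : ℝ) : ℝ := smoothStep (1 + d.κD) (1 + 2 * d.κD) (d.Xg t)

/-- **The height of the track**, `(1 - S₂) · P + S₂ · g`. [folklore] -/
def H₁ (t : ℝ) : ℝ := (1 - d.S₂ t) * d.P t + d.S₂ t * d.g t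

/-- The height of the arch itself (abstract form of `cLo t 1`). [folklore] -/
def v (t : ℝ) : ℝ := (1 - smoothStep (d.a + d.ε) (d.b - d.ε) t) * d.f t + smoothStep (d.a + d.ε) (d.b - d.ε) t * d.g t

/-! ### Elementary inequalities between the parameters -/

/-- `a_lt_b` (auxiliary). [folklore] -/
theorem a_lt_b : d.a < d.b := by linarith [d.hab, d.ε_pos]
/-- `lift_lt` (auxiliary). [folklore] -/
theorem lift_lt : d.b - d.ε < d.b - d.ε / 2 := by linarith [d.ε_pos]
/-- `guard_lt` (auxiliary). [folklore] -/
theorem guard_lt : d.b + d.ε / 2 < d.b + d.ε := by linarith [d.ε_pos]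
/-- `κD_lt_κ₀` (auxiliary). [folklore] -/
theorem κD_lt_κ₀ : d.κD < d.κ₀ := by linarith [d.κD_le, d.κD_pos]
/-- `κ₀_lt_one` (auxiliary). [folklore] -/
theorem κ₀_lt_one : d.κ₀ < 1 := by linarith [d.κ₀_le]
/-- `κD_le_eighth` (auxiliary). [folklore] -/
theorem κD_le_eighth : d.κD ≤ 8⁻¹ := by linarith [d.κD_le, d.κ₀_le]
/-- `xD_pos` (auxiliary). [folklore] -/
theorem xD_pos : 0 < d.xD := by rw [xD]; linarith [d.κD_le_eighth]
/-- `xD_lt_one` (auxiliary). [folklore] -/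
theorem xD_lt_one : d.xD < 1 := by rw [xD]; linarith [d.κD_pos]
/-- `one_sub_κ₀_lt_xD` (auxiliary). [folklore] -/
theorem one_sub_κ₀_lt_xD : 1 - d.κ₀ < d.xD := by rw [xD]; linarith [d.κD_lt_κ₀]
/-- `εℓ_lt_κD` (auxiliary). [folklore] -/
theorem εℓ_lt_κD : d.εℓ < d.κD := by linarith [d.εℓ_le, d.εℓ_pos]
/-- `blend_lt_top` (auxiliary). [folklore] -/
theorem blend_lt_top : 1 + 2 * d.κD < 2 - d.κ₀ := by linarith [d.κD_small, d.κD_pos]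
/-- `hpl_lt_hr1` (auxiliary). [folklore] -/
theorem hpl_lt_hr1 : d.hpl < d.hr1 := d.hpl_le.trans_lt d.hr_lt
/-- `fa_lt_hr0` (auxiliary). [folklore] -/
theorem fa_lt_hr0 : d.f d.a < d.hr0 := d.hpl_gt.trans_le d.hpl_le

/-! ### Smoothness -/

/-- `contDiff_Slift` (auxiliary). [folklore] -/
theorem contDiff_Slift : ContDiff ℝ ∞ d.Slift := contDiff_smoothStep _ _
/-- `contDiff_Hh` (auxiliary). [folklore] -/
theorem contDiff_Hh : ContDiff ℝ ∞ d.Hh := d.f_smooth.add (contDiff_const.mul d.contDiff_Slift)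
/-- `contDiff_ρrise` (auxiliary). [folklore] -/
theorem contDiff_ρrise : ContDiff ℝ ∞ d.ρrise := contDiff_const.mul (contDiff_smoothStep _ _)
/-- `contDiff_Sr` (auxiliary). [folklore] -/
theorem contDiff_Sr : ContDiff ℝ ∞ d.Sr := contDiff_smoothStep _ _
/-- `contDiff_ρt` (auxiliary). [folklore] -/
theorem contDiff_ρt : ContDiff ℝ ∞ d.ρt := d.contDiff_ρrise.add d.contDiff_Sr
/-- `contDiff_ρ₁` (auxiliary). [folklore] -/
theorem contDiff_ρ₁ : ContDiff ℝ ∞ d.ρ₁ := (contDiff_smoothMinConst _ _).comp d.contDiff_ρt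
/-- `contDiff_guard` (auxiliary). [folklore] -/
theorem contDiff_guard : ContDiff ℝ ∞ d.guard := contDiff_const.mul (contDiff_smoothStep _ _)
/-- `contDiff_Xl` (auxiliary). [folklore] -/
theorem contDiff_Xl : ContDiff ℝ ∞ d.Xl := d.contDiff_ρt.comp d.contDiff_Hh
/-- `contDiff_Xg` (auxiliary). [folklore] -/
theorem contDiff_Xg : ContDiff ℝ ∞ d.Xg := d.contDiff_Xl.add d.contDiff_guard
/-- `contDiff_X₁` (auxiliary). [folklore] -/
theorem contDiff_X₁ : ContDiff ℝ ∞ d.X₁ := (contDiff_smoothMinConst _ _).comp d.contDiff_Xg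
/-- `contDiff_ζ` (auxiliary). [folklore] -/
theorem contDiff_ζ : ContDiff ℝ ∞ d.ζ := contDiff_id.mul (contDiff_smoothStep _ _)
/-- `contDiff_P` (auxiliary). [folklore] -/
theorem contDiff_P : ContDiff ℝ ∞ d.P :=
  d.contDiff_Hh.sub (contDiff_const.mul (d.contDiff_ζ.comp (d.contDiff_Xg.sub contDiff_const)))
/-- `contDiff_S₂` (auxiliary). [folklore] -/
theorem contDiff_S₂ : ContDiff ℝ ∞ d.S₂ := (contDiff_smoothStep _ _).comp d.contDiff_Xg
/-- `contDiff_H₁` (auxiliary). [folklore] -/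
theorem contDiff_H₁ : ContDiff ℝ ∞ d.H₁ :=
  ((contDiff_const.sub d.contDiff_S₂).mul d.contDiff_P).add (d.contDiff_S₂.mul d.g_smooth)

/-! ### The edge heights -/

/-- `f` is strictly increasing on `(-∞, b + ε]`. [folklore] -/
theorem strictMonoOn_f : StrictMonoOn d.f (Iic (d.b + d.ε)) := by
  refine strictMonoOn_of_deriv_pos (convex_Iic _) d.f_smooth.continuous.continuousOn fun x hx ↦ ?_
  rw [interior_Iic] at hx
  exact d.f_deriv_pos x (le_of_lt hx)

/-- `f_le_f` (auxiliary). [folklore] -/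
theorem f_le_f {s t : ℝ} (hst : s ≤ t) (ht : t ≤ d.b + d.ε) : d.f s ≤ d.f t :=
  d.strictMonoOn_f.monotoneOn (show s ∈ Iic _ from hst.trans ht) (show t ∈ Iic _ from ht) hst

/-- `f_lt_f` (auxiliary). [folklore] -/
theorem f_lt_f {s t : ℝ} (hst : s < t) (ht : t ≤ d.b + d.ε) : d.f s < d.f t :=
  d.strictMonoOn_f (show s ∈ Iic _ from hst.le.trans ht) (show t ∈ Iic _ from ht) hst

/-- `g` is strictly decreasing on `[b - ε, ∞)`. [folklore] -/
theorem strictAntiOn_g : StrictAntiOn d.g (Ici (d.b - d.ε)) := by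
  refine strictAntiOn_of_deriv_neg (convex_Ici _) d.g_smooth.continuous.continuousOn fun x hx ↦ ?_
  rw [interior_Ici] at hx
  exact d.g_deriv_neg x (le_of_lt hx)

/-! ### The lift and the virtual height -/

/-- `Slift_mem_Icc` (auxiliary). [folklore] -/
theorem Slift_mem_Icc (t : ℝ) : d.Slift t ∈ Icc (0 : ℝ) 1 := smoothStep_mem_Icc _ _ _
/-- `Slift_of_le` (auxiliary). [folklore] -/
theorem Slift_of_le {t : ℝ} (ht : t ≤ d.b - d.ε) : d.Slift t = 0 := smoothStep_of_le d.lift_lt ht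
/-- `Slift_of_ge` (auxiliary). [folklore] -/
theorem Slift_of_ge {t : ℝ} (ht : d.b - d.ε / 2 ≤ t) : d.Slift t = 1 := smoothStep_of_ge d.lift_lt ht

/-- `Hh_of_le` (auxiliary). [folklore] -/
theorem Hh_of_le {t : ℝ} (ht : t ≤ d.b - d.ε) : d.Hh t = d.f t := by rw [Hh, d.Slift_of_le ht]; ring
/-- `Hh_of_ge` (auxiliary). [folklore] -/
theorem Hh_of_ge {t : ℝ} (ht : d.b - d.ε / 2 ≤ t) : d.Hh t = d.f t + d.ch := by rw [Hh, d.Slift_of_ge ht]; ring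

/-- `f_le_Hh` (auxiliary). [folklore] -/
theorem f_le_Hh (t : ℝ) : d.f t ≤ d.Hh t := by
  rw [Hh]; nlinarith [(d.Slift_mem_Icc t).1, d.ch_pos]

/-- `Hh_le` (auxiliary). [folklore] -/
theorem Hh_le (t : ℝ) : d.Hh t ≤ d.f t + d.ch := by
  rw [Hh]; nlinarith [(d.Slift_mem_Icc t).2, d.ch_pos]

/-- `hasDerivAt_Hh` (auxiliary). [folklore] -/
theorem hasDerivAt_Hh (t : ℝ) :
    HasDerivAt d.Hh (deriv d.f t + d.ch * deriv (smoothStep (d.b - d.ε) (d.b - d.ε / 2)) t) t := by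
  have h1 : HasDerivAt d.f (deriv d.f t) t := (d.f_smooth.differentiable (by simp) t).hasDerivAt
  have h2 : HasDerivAt d.Slift (deriv (smoothStep (d.b - d.ε) (d.b - d.ε / 2)) t) t :=
    ((contDiff_smoothStep _ _).differentiable (by simp) t).hasDerivAt
  exact h1.add (h2.const_mul d.ch)

/-- `deriv_f_le_deriv_Hh` (auxiliary). [folklore] -/
theorem deriv_f_le_deriv_Hh (t : ℝ) : deriv d.f t ≤ deriv d.Hh t := by
  rw [(d.hasDerivAt_Hh t).deriv]
  nlinarith [mul_nonneg d.ch_pos.le (deriv_smoothStep_nonneg d.lift_lt t)]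

/-- `deriv_Hh_pos` (auxiliary). [folklore] -/
theorem deriv_Hh_pos {t : ℝ} (ht : t ≤ d.b + d.ε) : 0 < deriv d.Hh t :=
  (d.f_deriv_pos t ht).trans_le (d.deriv_f_le_deriv_Hh t)

/-- The virtual height is strictly increasing on `(-∞, b + ε]`. [folklore] -/
theorem strictMonoOn_Hh : StrictMonoOn d.Hh (Iic (d.b + d.ε)) := by
  refine strictMonoOn_of_deriv_pos (convex_Iic _) d.contDiff_Hh.continuous.continuousOn fun x hx ↦ ?_
  rw [interior_Iic] at hx
  exact d.deriv_Hh_pos (le_of_lt hx)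

/-- `Hh_le_Hh` (auxiliary). [folklore] -/
theorem Hh_le_Hh {s t : ℝ} (hst : s ≤ t) (ht : t ≤ d.b + d.ε) : d.Hh s ≤ d.Hh t :=
  d.strictMonoOn_Hh.monotoneOn (show s ∈ Iic _ from hst.trans ht) (show t ∈ Iic _ from ht) hst

/-- `deriv_Hh_le_MH` (auxiliary). [folklore] -/
theorem deriv_Hh_le_MH {t : ℝ} (ht : t ∈ Icc (d.b - d.ε) (d.b + d.ε)) : deriv d.Hh t ≤ d.MH := by
  rw [(d.hasDerivAt_Hh t).deriv]; exact d.MH_ge t ht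

/-- `MH_pos` (auxiliary). [folklore] -/
theorem MH_pos : 0 < d.MH :=
  (d.deriv_Hh_pos (t := d.b - d.ε) (by linarith [d.ε_pos])).trans_le (d.deriv_Hh_le_MH ⟨le_rfl, by linarith [d.ε_pos]⟩)

/-- On the landing window and beyond, `Hh > f (b - ε)`; up to `b - ε`, `Hh ≤ f (b - ε)`. [folklore] -/
theorem Hh_le_of_le {t : ℝ} (ht : t ≤ d.b - d.ε) : d.Hh t ≤ d.f (d.b - d.ε) := by
  rw [d.Hh_of_le ht]; exact d.f_le_f ht (by linarith [d.ε_pos])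

/-- `hr1_le_Hh` (auxiliary). [folklore] -/
theorem hr1_le_Hh {t : ℝ} (ht : t ∈ Icc (d.b - d.ε / 2) (d.b + d.ε)) : d.hr1 ≤ d.Hh t := by
  rw [d.Hh_of_ge ht.1]; linarith [d.hr1_le, d.f_le_f ht.1 ht.2]

/-! ### The height profiles `ρrise`, `Sr`, `ρ̃`, `ρ₁` -/

/-- `ρrise_of_le` (auxiliary). [folklore] -/
theorem ρrise_of_le {h : ℝ} (hh : h ≤ d.f d.a) : d.ρrise h = 0 := by
  rw [ρrise, smoothStep_of_le d.hpl_gt hh, mul_zero]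

/-- `ρrise_of_ge` (auxiliary). [folklore] -/
theorem ρrise_of_ge {h : ℝ} (hh : d.hpl ≤ h) : d.ρrise h = 1 - d.κ₀ := by
  rw [ρrise, smoothStep_of_ge d.hpl_gt hh, mul_one]

/-- `ρrise_mem_Icc` (auxiliary). [folklore] -/
theorem ρrise_mem_Icc (h : ℝ) : d.ρrise h ∈ Icc (0 : ℝ) (1 - d.κ₀) := by
  have := smoothStep_mem_Icc (d.f d.a) d.hpl h
  rw [ρrise]; constructor <;> nlinarith [this.1, this.2, d.κ₀_lt_one]

/-- `ρrise_pos_of_gt` (auxiliary). [folklore] -/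
theorem ρrise_pos_of_gt {h : ℝ} (hh : d.f d.a < h) : 0 < d.ρrise h := by
  rw [ρrise]
  refine mul_pos (by linarith [d.κ₀_lt_one]) ?_
  rcases lt_or_ge h d.hpl with h1 | h1
  · exact (smoothStep_mem_Ioo d.hpl_gt ⟨hh, h1⟩).1
  · rw [smoothStep_of_ge d.hpl_gt h1]; exact one_pos

/-- `monotone_ρrise` (auxiliary). [folklore] -/
theorem monotone_ρrise : Monotone d.ρrise := fun _ _ hxy ↦ by
  rw [ρrise, ρrise]
  exact mul_le_mul_of_nonneg_left (monotone_smoothStep d.hpl_gt.le hxy) (by linarith [d.κ₀_lt_one])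

/-- `Sr_mem_Icc` (auxiliary). [folklore] -/
theorem Sr_mem_Icc (h : ℝ) : d.Sr h ∈ Icc (0 : ℝ) 1 := smoothStep_mem_Icc _ _ _
/-- `Sr_of_le` (auxiliary). [folklore] -/
theorem Sr_of_le {h : ℝ} (hh : h ≤ d.hr0) : d.Sr h = 0 := smoothStep_of_le d.hr_lt hh
/-- `Sr_of_ge` (auxiliary). [folklore] -/
theorem Sr_of_ge {h : ℝ} (hh : d.hr1 ≤ h) : d.Sr h = 1 := smoothStep_of_ge d.hr_lt hh
/-- `monotone_Sr` (auxiliary). [folklore] -/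
theorem monotone_Sr : Monotone d.Sr := monotone_smoothStep d.hr_lt.le
/-- `strictMonoOn_Sr` (auxiliary). [folklore] -/
theorem strictMonoOn_Sr : StrictMonoOn d.Sr (Icc d.hr0 d.hr1) := strictMonoOn_smoothStep d.hr_lt

/-- `Sr_pos_iff` (auxiliary). [folklore] -/
theorem Sr_pos_iff {h : ℝ} : 0 < d.Sr h ↔ d.hr0 < h := by
  constructor
  · intro hp; by_contra hle; rw [d.Sr_of_le (le_of_not_gt hle)] at hp; exact lt_irrefl _ hp
  · intro hh
    rcases lt_or_ge h d.hr1 with h1 | h1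
    · exact (smoothStep_mem_Ioo d.hr_lt ⟨hh, h1⟩).1
    · rw [d.Sr_of_ge h1]; exact one_pos

/-- `Sr_lt_one_iff` (auxiliary). [folklore] -/
theorem Sr_lt_one_iff {h : ℝ} : d.Sr h < 1 ↔ h < d.hr1 := by
  constructor
  · intro hp; by_contra hle; rw [d.Sr_of_ge (le_of_not_gt hle)] at hp; exact lt_irrefl _ hp
  · intro hh
    rcases le_or_gt h d.hr0 with h1 | h1
    · rw [d.Sr_of_le h1]; exact one_pos
    · exact (smoothStep_mem_Ioo d.hr_lt ⟨h1, hh⟩).2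

/-- `monotone_ρt` (auxiliary). [folklore] -/
theorem monotone_ρt : Monotone d.ρt := fun _ _ hxy ↦ add_le_add (d.monotone_ρrise hxy) (d.monotone_Sr hxy)

/-- `ρt_nonneg` (auxiliary). [folklore] -/
theorem ρt_nonneg (h : ℝ) : 0 ≤ d.ρt h := add_nonneg (d.ρrise_mem_Icc h).1 (d.Sr_mem_Icc h).1

/-- `ρt_le` (auxiliary). [folklore] -/
theorem ρt_le (h : ℝ) : d.ρt h ≤ 2 - d.κ₀ := by
  have h1 := (d.ρrise_mem_Icc h).2; have h2 := (d.Sr_mem_Icc h).2; rw [ρt]; linarith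

/-- Below `h_r0` the profile is the rise profile (the landing step has not started). [folklore] -/
theorem ρt_of_le_hr0 {h : ℝ} (hh : h ≤ d.hr0) : d.ρt h = d.ρrise h := by rw [ρt, d.Sr_of_le hh, add_zero]

/-- From the plateau height on, `ρ̃ = 1 - κ₀ + Sr`. [folklore] -/
theorem ρt_of_ge_hpl {h : ℝ} (hh : d.hpl ≤ h) : d.ρt h = 1 - d.κ₀ + d.Sr h := by rw [ρt, d.ρrise_of_ge hh]

/-- `ρt_le_of_le_hr0` (auxiliary). [folklore] -/
theorem ρt_le_of_le_hr0 {h : ℝ} (hh : h ≤ d.hr0) : d.ρt h ≤ 1 - d.κ₀ := by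
  rw [d.ρt_of_le_hr0 hh]; exact (d.ρrise_mem_Icc h).2

/-- `ρt_of_ge_hr1` (auxiliary). [folklore] -/
theorem ρt_of_ge_hr1 {h : ℝ} (hh : d.hr1 ≤ h) : d.ρt h = 2 - d.κ₀ := by
  rw [d.ρt_of_ge_hpl (d.hpl_lt_hr1.le.trans hh), d.Sr_of_ge hh]; ring

/-- `ρt_of_le_fa` (auxiliary). [folklore] -/
theorem ρt_of_le_fa {h : ℝ} (hh : h ≤ d.f d.a) : d.ρt h = 0 := by
  rw [d.ρt_of_le_hr0 (hh.trans d.fa_lt_hr0.le), d.ρrise_of_le hh]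

/-- `ρt_pos_of_gt` (auxiliary). [folklore] -/
theorem ρt_pos_of_gt {h : ℝ} (hh : d.f d.a < h) : 0 < d.ρt h :=
  add_pos_of_pos_of_nonneg (d.ρrise_pos_of_gt hh) (d.Sr_mem_Icc h).1

/-- Above the plateau gap the profile reads the landing step: `ρ̃ h > 1 - κ₀ ↔ h > h_r0`, and then
`ρ̃ h = 1 - κ₀ + Sr h`. [folklore] -/
theorem hr0_lt_of_lt_ρt {h : ℝ} (hh : 1 - d.κ₀ < d.ρt h) : d.hr0 < h := by
  by_contra hle; exact lt_irrefl _ (hh.trans_le (d.ρt_le_of_le_hr0 (le_of_not_gt hle)))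

/-- `ρt_eq_of_lt_ρt` (auxiliary). [folklore] -/
theorem ρt_eq_of_lt_ρt {h : ℝ} (hh : 1 - d.κ₀ < d.ρt h) : d.ρt h = 1 - d.κ₀ + d.Sr h :=
  d.ρt_of_ge_hpl (d.hpl_le.trans (d.hr0_lt_of_lt_ρt hh).le)

/-- `ρ̃` is strictly increasing across the landing step, in the following usable form: if
`h < h'`, `1 - κ₀ < ρ̃ h'` and `ρ̃ h < 2 - κ₀` then `ρ̃ h < ρ̃ h'`. [folklore] -/
theorem ρt_lt_ρt {h h' : ℝ} (hlt : h < h') (h1 : 1 - d.κ₀ < d.ρt h') (h2 : d.ρt h < 2 - d.κ₀) :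
    d.ρt h < d.ρt h' := by
  have hh' : d.hr0 < h' := d.hr0_lt_of_lt_ρt h1
  rcases le_or_gt h d.hr0 with hle | hgt
  · exact (d.ρt_le_of_le_hr0 hle).trans_lt h1
  · -- both above `h_r0`: `ρ̃ = 1 - κ₀ + Sr`
    have hhr1 : h < d.hr1 := by
      by_contra h3; rw [d.ρt_of_ge_hr1 (le_of_not_gt h3)] at h2; exact lt_irrefl _ h2
    rw [d.ρt_of_ge_hpl (d.hpl_le.trans hgt.le), d.ρt_of_ge_hpl (d.hpl_le.trans hh'.le)]
    have : d.Sr h < d.Sr h' := by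
      rcases le_or_gt h' d.hr1 with h4 | h4
      · exact d.strictMonoOn_Sr ⟨hgt.le, hhr1.le⟩ ⟨hh'.le, h4⟩ hlt
      · rw [d.Sr_of_ge h4.le]; exact d.Sr_lt_one_iff.2 hhr1
    linarith

/-- `ρ₁_mem_Icc` (auxiliary). [folklore] -/
theorem ρ₁_mem_Icc (h : ℝ) : d.ρ₁ h ∈ Icc (0 : ℝ) 1 := by
  have h0 := d.ρt_nonneg h
  rcases le_or_gt (d.ρt h) 1 with h1 | h1
  · have hm := smoothMinConst_mem 1 d.εℓ (d.ρt h)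
    rw [min_eq_left h1, max_eq_right h1] at hm
    exact ⟨h0.trans hm.1, hm.2⟩
  · rw [ρ₁, smoothMinConst_of_ge d.εℓ_pos h1.le]; exact ⟨zero_le_one, le_rfl⟩

/-- `ρ₁_of_le_fa` (auxiliary). [folklore] -/
theorem ρ₁_of_le_fa {h : ℝ} (hh : h ≤ d.f d.a) : d.ρ₁ h = 0 := by
  rw [ρ₁, d.ρt_of_le_fa hh, smoothMinConst_of_le d.εℓ_pos (by linarith [d.εℓ_lt_κD, d.κD_le_eighth])]

/-! ### The guard and the abscissa drivers `Xl`, `Xg` -/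

/-- `guard_of_le` (auxiliary). [folklore] -/
theorem guard_of_le {t : ℝ} (ht : t ≤ d.b + d.ε / 2) : d.guard t = 0 := by
  rw [guard, smoothStep_of_le d.guard_lt ht, mul_zero]

/-- `guard_of_ge` (auxiliary). [folklore] -/
theorem guard_of_ge {t : ℝ} (ht : d.b + d.ε ≤ t) : d.guard t = 2 := by
  rw [guard, smoothStep_of_ge d.guard_lt ht, mul_one]

/-- `guard_mem_Icc` (auxiliary). [folklore] -/
theorem guard_mem_Icc (t : ℝ) : d.guard t ∈ Icc (0 : ℝ) 2 := by
  have := smoothStep_mem_Icc (d.b + d.ε / 2) (d.b + d.ε) t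
  rw [guard]; constructor <;> nlinarith [this.1, this.2]

/-- `monotone_guard` (auxiliary). [folklore] -/
theorem monotone_guard : Monotone d.guard := fun _ _ hxy ↦ by
  rw [guard, guard]; exact mul_le_mul_of_nonneg_left (monotone_smoothStep d.guard_lt.le hxy) (by norm_num)

/-- `guard_eventuallyEq_zero` (auxiliary). [folklore] -/
theorem guard_eventuallyEq_zero {t : ℝ} (ht : t < d.b + d.ε / 2) : d.guard =ᶠ[𝓝 t] fun _ ↦ (0 : ℝ) :=
  Filter.eventuallyEq_of_mem (Iio_mem_nhds ht) fun _ hs ↦ d.guard_of_le (le_of_lt hs)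

/-- Up to `b + ε/2` the guard is off: `Xg = Xl`. [folklore] -/
theorem Xg_of_le {t : ℝ} (ht : t ≤ d.b + d.ε / 2) : d.Xg t = d.Xl t := by rw [Xg, d.guard_of_le ht, add_zero]

/-- `Xg_eventuallyEq_Xl` (auxiliary). [folklore] -/
theorem Xg_eventuallyEq_Xl {t : ℝ} (ht : t < d.b + d.ε / 2) : d.Xg =ᶠ[𝓝 t] d.Xl := by
  filter_upwards [Iio_mem_nhds ht] with s hs using d.Xg_of_le (le_of_lt hs)

/-- `Xl_nonneg` (auxiliary). [folklore] -/
theorem Xl_nonneg (t : ℝ) : 0 ≤ d.Xl t := d.ρt_nonneg _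
/-- `Xl_le` (auxiliary). [folklore] -/
theorem Xl_le (t : ℝ) : d.Xl t ≤ 2 - d.κ₀ := d.ρt_le _
/-- `Xg_nonneg` (auxiliary). [folklore] -/
theorem Xg_nonneg (t : ℝ) : 0 ≤ d.Xg t := add_nonneg (d.Xl_nonneg t) (d.guard_mem_Icc t).1
/-- `Xl_le_Xg` (auxiliary). [folklore] -/
theorem Xl_le_Xg (t : ℝ) : d.Xl t ≤ d.Xg t := by rw [Xg]; linarith [(d.guard_mem_Icc t).1]

/-- Up to `a` the raw abscissa vanishes. [folklore] -/
theorem Xl_of_le_a {t : ℝ} (ht : t ≤ d.a) : d.Xl t = 0 := by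
  rw [Xl, d.Hh_of_le (by linarith [d.hab, d.ε_pos])]
  exact d.ρt_of_le_fa (d.f_le_f ht (by linarith [d.hab, d.ε_pos]))

/-- `Xg_of_le_a` (auxiliary). [folklore] -/
theorem Xg_of_le_a {t : ℝ} (ht : t ≤ d.a) : d.Xg t = 0 := by
  rw [d.Xg_of_le (by linarith [d.hab, d.ε_pos]), d.Xl_of_le_a ht]

/-- Up to `b - ε` the raw abscissa is at most `1 - κ₀` (the landing step has not started). [folklore] -/
theorem Xl_le_of_le {t : ℝ} (ht : t ≤ d.b - d.ε) : d.Xl t ≤ 1 - d.κ₀ :=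
  d.ρt_le_of_le_hr0 ((d.Hh_le_of_le ht).trans d.hr0_gt.le)

/-- `Xg_le_of_le` (auxiliary). [folklore] -/
theorem Xg_le_of_le {t : ℝ} (ht : t ≤ d.b - d.ε) : d.Xg t ≤ 1 - d.κ₀ := by
  rw [d.Xg_of_le (by linarith [d.ε_pos])]; exact d.Xl_le_of_le ht

/-- On `[b - ε/2, b + ε]` the raw abscissa is `2 - κ₀`. [folklore] -/
theorem Xl_of_mem {t : ℝ} (ht : t ∈ Icc (d.b - d.ε / 2) (d.b + d.ε)) : d.Xl t = 2 - d.κ₀ :=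
  d.ρt_of_ge_hr1 (d.hr1_le_Hh ht)

/-- From `b - ε/2` on, the guarded abscissa is at least `2 - κ₀`. [folklore] -/
theorem le_Xg_of_ge {t : ℝ} (ht : d.b - d.ε / 2 ≤ t) : 2 - d.κ₀ ≤ d.Xg t := by
  rcases le_or_gt t (d.b + d.ε) with h | h
  · rw [Xg, d.Xl_of_mem ⟨ht, h⟩]; linarith [(d.guard_mem_Icc t).1]
  · rw [Xg, d.guard_of_ge h.le]; linarith [d.Xl_nonneg t, d.κ₀_pos]

/-- After `a` (and up to `b + ε`) the raw abscissa is positive. [folklore] -/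
theorem Xl_pos_of_gt {t : ℝ} (ht : d.a < t) (ht' : t ≤ d.b + d.ε) : 0 < d.Xl t :=
  d.ρt_pos_of_gt ((d.f_lt_f ht ht').trans_le (d.f_le_Hh t))

/-- `Xg_pos_of_gt` (auxiliary). [folklore] -/
theorem Xg_pos_of_gt {t : ℝ} (ht : d.a < t) : 0 < d.Xg t := by
  rcases le_or_gt t (d.b + d.ε) with h | h
  · exact (d.Xl_pos_of_gt ht h).trans_le (d.Xl_le_Xg t)
  · rw [Xg, d.guard_of_ge h.le]; linarith [d.Xl_nonneg t]

/-- The raw abscissa is non-decreasing on `(-∞, b + ε]`. [folklore] -/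
theorem Xl_le_Xl {s t : ℝ} (hst : s ≤ t) (ht : t ≤ d.b + d.ε) : d.Xl s ≤ d.Xl t :=
  d.monotone_ρt (d.Hh_le_Hh hst ht)

/-- `Xg_le_Xg` (auxiliary). [folklore] -/
theorem Xg_le_Xg {s t : ℝ} (hst : s ≤ t) (ht : t ≤ d.b + d.ε) : d.Xg s ≤ d.Xg t :=
  add_le_add (d.Xl_le_Xl hst ht) (d.monotone_guard hst)

/-- **Strictness across the landing levels**: for `s < t ≤ b + ε` with `1 - κ₀ < Xl t` and
`Xl s < 2 - κ₀`, `Xl s < Xl t`. [folklore] -/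
theorem Xl_lt_Xl {s t : ℝ} (hst : s < t) (ht : t ≤ d.b + d.ε) (h1 : 1 - d.κ₀ < d.Xl t)
    (h2 : d.Xl s < 2 - d.κ₀) : d.Xl s < d.Xl t :=
  d.ρt_lt_ρt (d.strictMonoOn_Hh (show s ∈ Iic _ from hst.le.trans ht) (show t ∈ Iic _ from ht) hst) h1 h2

/-- The derivative of the raw abscissa. [folklore] -/
theorem hasDerivAt_Xl (t : ℝ) : HasDerivAt d.Xl (deriv d.ρt (d.Hh t) * deriv d.Hh t) t :=
  (d.contDiff_ρt.differentiable (by simp) _).hasDerivAt.comp t (d.contDiff_Hh.differentiable (by simp) t).hasDerivAt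

/-- `hasDerivAt_ρt` (auxiliary). [folklore] -/
theorem hasDerivAt_ρt (h : ℝ) :
    HasDerivAt d.ρt ((1 - d.κ₀) * deriv (smoothStep (d.f d.a) d.hpl) h + deriv (smoothStep d.hr0 d.hr1) h) h := by
  have h1 : HasDerivAt (smoothStep (d.f d.a) d.hpl) (deriv (smoothStep (d.f d.a) d.hpl) h) h :=
    ((contDiff_smoothStep _ _).differentiable (by simp) h).hasDerivAt
  have h2 : HasDerivAt (smoothStep d.hr0 d.hr1) (deriv (smoothStep d.hr0 d.hr1) h) h :=
    ((contDiff_smoothStep _ _).differentiable (by simp) h).hasDerivAt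
  exact (h1.const_mul _).add h2

/-- `deriv_ρt_nonneg` (auxiliary). [folklore] -/
theorem deriv_ρt_nonneg (h : ℝ) : 0 ≤ deriv d.ρt h := by
  rw [(d.hasDerivAt_ρt h).deriv]
  exact add_nonneg (mul_nonneg (by linarith [d.κ₀_lt_one]) (deriv_smoothStep_nonneg d.hpl_gt h))
    (deriv_smoothStep_nonneg d.hr_lt h)

/-- `deriv_Sr_le_deriv_ρt` (auxiliary). [folklore] -/
theorem deriv_Sr_le_deriv_ρt (h : ℝ) : deriv (smoothStep d.hr0 d.hr1) h ≤ deriv d.ρt h := by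
  rw [(d.hasDerivAt_ρt h).deriv]
  nlinarith [mul_nonneg (show (0:ℝ) ≤ 1 - d.κ₀ by linarith [d.κ₀_lt_one]) (deriv_smoothStep_nonneg d.hpl_gt h)]

/-- `deriv_Xl_nonneg` (auxiliary). [folklore] -/
theorem deriv_Xl_nonneg {t : ℝ} (ht : t ≤ d.b + d.ε) : 0 ≤ deriv d.Xl t := by
  rw [(d.hasDerivAt_Xl t).deriv]
  exact mul_nonneg (d.deriv_ρt_nonneg _) (d.deriv_Hh_pos ht).le

/-- **The abscissa speed on the landing levels**: `Xl' ≥ vmin` whenever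
`Sr (Hh t) ∈ [κ₀ - 3κ_D, κ₀ + 3κ_D]`, `t ∈ [b - ε, b - ε/2]`. [folklore] -/
theorem vmin_le_deriv_Xl {t : ℝ} (ht : t ∈ Icc (d.b - d.ε) (d.b - d.ε / 2))
    (hS : d.Sr (d.Hh t) ∈ Icc (d.κ₀ - 3 * d.κD) (d.κ₀ + 3 * d.κD)) : d.vmin ≤ deriv d.Xl t := by
  have h1 := d.vmin_le t ht hS
  rw [(d.hasDerivAt_Xl t).deriv]
  calc d.vmin ≤ deriv (smoothStep d.hr0 d.hr1) (d.Hh t) * deriv d.f t := h1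
    _ ≤ deriv d.ρt (d.Hh t) * deriv d.Hh t :=
        mul_le_mul (d.deriv_Sr_le_deriv_ρt _) (d.deriv_f_le_deriv_Hh t)
          (d.f_deriv_pos t (by linarith [ht.2, d.ε_pos])).le (d.deriv_ρt_nonneg _)

/-- Up to `b + ε/2`, `Xg' = Xl'`. [folklore] -/
theorem deriv_Xg_of_lt {t : ℝ} (ht : t < d.b + d.ε / 2) : deriv d.Xg t = deriv d.Xl t :=
  (d.Xg_eventuallyEq_Xl ht).deriv_eq

/-- `hasDerivAt_Xg` (auxiliary). [folklore] -/
theorem hasDerivAt_Xg (t : ℝ) :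
    HasDerivAt d.Xg (deriv d.Xl t + 2 * deriv (smoothStep (d.b + d.ε / 2) (d.b + d.ε)) t) t := by
  have h1 : HasDerivAt d.Xl (deriv d.Xl t) t := (d.contDiff_Xl.differentiable (by simp) t).hasDerivAt
  have h2 : HasDerivAt (smoothStep (d.b + d.ε / 2) (d.b + d.ε)) (deriv (smoothStep (d.b + d.ε / 2) (d.b + d.ε)) t) t :=
    ((contDiff_smoothStep _ _).differentiable (by simp) t).hasDerivAt
  exact h1.add (h2.const_mul 2)

/-- `deriv_Xg_nonneg` (auxiliary). [folklore] -/
theorem deriv_Xg_nonneg {t : ℝ} (ht : t ≤ d.b + d.ε) : 0 ≤ deriv d.Xg t := by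
  rw [(d.hasDerivAt_Xg t).deriv]
  exact add_nonneg (d.deriv_Xl_nonneg ht) (mul_nonneg (by norm_num) (deriv_smoothStep_nonneg d.guard_lt t))

/-! ### The abscissa `X₁` -/

/-- `X₁_eq_Xg_of_le` (auxiliary). [folklore] -/
theorem X₁_eq_Xg_of_le {t : ℝ} (ht : d.Xg t ≤ 1 - d.εℓ) : d.X₁ t = d.Xg t := smoothMinConst_of_le d.εℓ_pos ht

/-- `X₁_eq_one_of_ge` (auxiliary). [folklore] -/
theorem X₁_eq_one_of_ge {t : ℝ} (ht : 1 ≤ d.Xg t) : d.X₁ t = 1 := smoothMinConst_of_ge d.εℓ_pos ht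

/-- `X₁_lt_one_of_Xg_lt` (auxiliary). [folklore] -/
theorem X₁_lt_one_of_Xg_lt {t : ℝ} (ht : d.Xg t < 1) : d.X₁ t < 1 := by
  rw [X₁, smoothMinConst]
  have hS1 : smoothStep (1 - d.εℓ) 1 (d.Xg t) < 1 := by
    rcases le_or_gt (d.Xg t) (1 - d.εℓ) with h | h
    · rw [smoothStep_of_le (by linarith [d.εℓ_pos]) h]; norm_num
    · have := strictMonoOn_smoothStep (a := 1 - d.εℓ) (b := 1) (by linarith [d.εℓ_pos]) ⟨h.le, ht.le⟩
        ⟨by linarith [d.εℓ_pos], le_rfl⟩ ht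
      rwa [smoothStep_of_ge (by linarith [d.εℓ_pos]) le_rfl] at this
  nlinarith

/-- For driver values in `[0, 1]`, `X₁ ≥ Xg`. [folklore] -/
theorem Xg_le_X₁_of_le {t : ℝ} (ht : d.Xg t ≤ 1) : d.Xg t ≤ d.X₁ t := by
  have hm := (smoothMinConst_mem 1 d.εℓ (d.Xg t)).1
  rwa [min_eq_left ht] at hm

/-- `X₁_mem_Icc` (auxiliary). [folklore] -/
theorem X₁_mem_Icc (t : ℝ) : d.X₁ t ∈ Icc (0 : ℝ) 1 := by
  have h0 := d.Xg_nonneg t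
  rcases le_or_gt (d.Xg t) 1 with h | h
  · have hm := smoothMinConst_mem 1 d.εℓ (d.Xg t)
    rw [min_eq_left h, max_eq_right h] at hm
    exact ⟨h0.trans hm.1, hm.2⟩
  · rw [d.X₁_eq_one_of_ge h.le]; exact ⟨zero_le_one, le_rfl⟩

/-- Up to `a` the abscissa vanishes. [folklore] -/
theorem X₁_of_le_a {t : ℝ} (ht : t ≤ d.a) : d.X₁ t = 0 := by
  rw [d.X₁_eq_Xg_of_le (by rw [d.Xg_of_le_a ht]; linarith [d.εℓ_lt_κD, d.κD_le_eighth]), d.Xg_of_le_a ht]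

/-- **From `b - ε/2` on the abscissa is `1`.** [folklore] -/
theorem X₁_of_ge {t : ℝ} (ht : d.b - d.ε / 2 ≤ t) : d.X₁ t = 1 :=
  d.X₁_eq_one_of_ge (by linarith [d.le_Xg_of_ge ht, d.κ₀_lt_one])

/-- **Up to `b - ε` the abscissa is `< 1`** (indeed `≤ 1 - κ₀ < x_D`). [folklore] -/
theorem X₁_lt_one_of_le {t : ℝ} (ht : t ≤ d.b - d.ε) : d.X₁ t < 1 :=
  d.X₁_lt_one_of_Xg_lt (by linarith [d.Xg_le_of_le ht, d.κ₀_pos])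

/-- `X₁_pos_of_gt` (auxiliary). [folklore] -/
theorem X₁_pos_of_gt {t : ℝ} (ht : d.a < t) : 0 < d.X₁ t := by
  have h0 := d.Xg_pos_of_gt ht
  rcases le_or_gt (d.Xg t) 1 with h | h
  · exact h0.trans_le (d.Xg_le_X₁_of_le h)
  · rw [d.X₁_eq_one_of_ge h.le]; exact one_pos

/-- `X₁ t = 0` forces `t ≤ a`. [folklore] -/
theorem le_a_of_X₁_eq_zero {t : ℝ} (h : d.X₁ t = 0) : t ≤ d.a := by
  by_contra ht; exact (d.X₁_pos_of_gt (lt_of_not_ge ht)).ne' h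

/-- **The abscissa is non-decreasing.** [folklore] -/
theorem deriv_X₁_nonneg (t : ℝ) : 0 ≤ deriv d.X₁ t := by
  rcases lt_or_ge t (d.b + d.ε) with htb | htb
  · rcases le_or_gt (d.Xg t) 1 with h | h
    · exact deriv_smoothMinConst_comp_nonneg d.εℓ_pos (d.contDiff_Xg.differentiable (by simp) t) h
        (d.deriv_Xg_nonneg htb.le)
    · have hev : d.X₁ =ᶠ[𝓝 t] fun _ ↦ (1 : ℝ) := by
        have ho : IsOpen {s | 1 < d.Xg s} := isOpen_lt continuous_const d.contDiff_Xg.continuous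
        filter_upwards [ho.mem_nhds h] with s hs using d.X₁_eq_one_of_ge (le_of_lt hs)
      rw [hev.deriv_eq, deriv_const]
  · -- past `b + ε/2` the abscissa is locally `1`
    have hev : d.X₁ =ᶠ[𝓝 t] fun _ ↦ (1 : ℝ) := by
      filter_upwards [Ioi_mem_nhds (show d.b - d.ε / 2 < t by linarith [d.ε_pos])] with s hs
        using d.X₁_of_ge (le_of_lt hs)
    rw [hev.deriv_eq, deriv_const]

/-! ### The landing levels: tip time `t_D`, landing time `t_L`, blend-complete time `t₂` -/

/-- The raw abscissa runs from `≤ 1 - κ₀` at `b - ε` to `2 - κ₀` at `b - ε/2`; every level strictly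
in between is attained in `(b - ε, b - ε/2)`. [folklore] -/
theorem exists_level {x : ℝ} (hx1 : 1 - d.κ₀ < x) (hx2 : x < 2 - d.κ₀) :
    ∃ t ∈ Ioo (d.b - d.ε) (d.b - d.ε / 2), d.Xl t = x := by
  have hcont : ContinuousOn d.Xl (Icc (d.b - d.ε) (d.b - d.ε / 2)) := d.contDiff_Xl.continuous.continuousOn
  have h := intermediate_value_Ioo d.lift_lt.le hcont
  have h1 : d.Xl (d.b - d.ε) < x := (d.Xl_le_of_le le_rfl).trans_lt hx1
  have h2 : x < d.Xl (d.b - d.ε / 2) := by rw [d.Xl_of_mem ⟨le_rfl, by linarith [d.ε_pos]⟩]; exact hx2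
  obtain ⟨t, ht, hXt⟩ := h ⟨h1, h2⟩
  exact ⟨t, ht, hXt⟩

/-- `exists_tD` (auxiliary). [folklore] -/
theorem exists_tD : ∃ t ∈ Ioo (d.b - d.ε) (d.b - d.ε / 2), d.Xl t = d.xD :=
  d.exists_level d.one_sub_κ₀_lt_xD (by rw [xD]; linarith [d.κ₀_lt_one, d.κD_pos])

/-- `exists_tL` (auxiliary). [folklore] -/
theorem exists_tL : ∃ t ∈ Ioo (d.b - d.ε) (d.b - d.ε / 2), d.Xl t = 1 :=
  d.exists_level (by linarith [d.κ₀_pos]) (by linarith [d.κ₀_lt_one])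

/-- `exists_t₂` (auxiliary). [folklore] -/
theorem exists_t₂ : ∃ t ∈ Ioo (d.b - d.ε) (d.b - d.ε / 2), d.Xl t = 1 + 2 * d.κD :=
  d.exists_level (by linarith [d.κ₀_pos, d.κD_pos]) d.blend_lt_top

/-- **The tip time**: `Xl t_D = x_D = 1 - κ_D`. [folklore] -/
def tD : ℝ := Classical.choose d.exists_tD
/-- **The landing time**: `Xl t_L = 1`. [folklore] -/
def tL : ℝ := Classical.choose d.exists_tL
/-- The blend-complete time: `Xl t₂ = 1 + 2κ_D`. [folklore] -/
def t₂ : ℝ := Classical.choose d.exists_t₂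

/-- `tD_mem` (auxiliary). [folklore] -/
theorem tD_mem : d.tD ∈ Ioo (d.b - d.ε) (d.b - d.ε / 2) := (Classical.choose_spec d.exists_tD).1
/-- `Xl_tD` (auxiliary). [folklore] -/
theorem Xl_tD : d.Xl d.tD = d.xD := (Classical.choose_spec d.exists_tD).2
/-- `tL_mem` (auxiliary). [folklore] -/
theorem tL_mem : d.tL ∈ Ioo (d.b - d.ε) (d.b - d.ε / 2) := (Classical.choose_spec d.exists_tL).1
/-- `Xl_tL` (auxiliary). [folklore] -/
theorem Xl_tL : d.Xl d.tL = 1 := (Classical.choose_spec d.exists_tL).2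
/-- `t₂_mem` (auxiliary). [folklore] -/
theorem t₂_mem : d.t₂ ∈ Ioo (d.b - d.ε) (d.b - d.ε / 2) := (Classical.choose_spec d.exists_t₂).1
/-- `Xl_t₂` (auxiliary). [folklore] -/
theorem Xl_t₂ : d.Xl d.t₂ = 1 + 2 * d.κD := (Classical.choose_spec d.exists_t₂).2

/-- `a_lt_tD` (auxiliary). [folklore] -/
theorem a_lt_tD : d.a < d.tD := by linarith [d.tD_mem.1, d.hab, d.ε_pos]
/-- `a_lt_tL` (auxiliary). [folklore] -/
theorem a_lt_tL : d.a < d.tL := by linarith [d.tL_mem.1, d.hab, d.ε_pos]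
/-- `tL_lt` (auxiliary). [folklore] -/
theorem tL_lt : d.tL < d.b + d.ε / 2 := by linarith [d.tL_mem.2, d.ε_pos]
/-- `tD_lt` (auxiliary). [folklore] -/
theorem tD_lt : d.tD < d.b + d.ε / 2 := by linarith [d.tD_mem.2, d.ε_pos]
/-- `t₂_lt` (auxiliary). [folklore] -/
theorem t₂_lt : d.t₂ < d.b + d.ε / 2 := by linarith [d.t₂_mem.2, d.ε_pos]

/-- `Xg_tD` (auxiliary). [folklore] -/
theorem Xg_tD : d.Xg d.tD = d.xD := by rw [d.Xg_of_le d.tD_lt.le, d.Xl_tD]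
/-- `Xg_tL` (auxiliary). [folklore] -/
theorem Xg_tL : d.Xg d.tL = 1 := by rw [d.Xg_of_le d.tL_lt.le, d.Xl_tL]
/-- `Xg_t₂` (auxiliary). [folklore] -/
theorem Xg_t₂ : d.Xg d.t₂ = 1 + 2 * d.κD := by rw [d.Xg_of_le d.t₂_lt.le, d.Xl_t₂]

/-- Below an interior landing level: for `t < s ≤ b + ε` with `Xl s ∈ (1 - κ₀, 2 - κ₀)`,
`Xl t < Xl s`. [folklore] -/
theorem Xl_lt_of_lt {t s : ℝ} (hts : t < s) (hs : s ≤ d.b + d.ε) (h1 : 1 - d.κ₀ < d.Xl s)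
    (h2 : d.Xl s < 2 - d.κ₀) : d.Xl t < d.Xl s :=
  d.Xl_lt_Xl hts hs h1 ((d.Xl_le_Xl hts.le hs).trans_lt h2)

/-- Above an interior landing level: for `s < t ≤ b + ε` with `Xl s ∈ (1 - κ₀, 2 - κ₀)`,
`Xl s < Xl t`. [folklore] -/
theorem Xl_lt_of_gt {s t : ℝ} (hst : s < t) (ht : t ≤ d.b + d.ε) (h1 : 1 - d.κ₀ < d.Xl s)
    (h2 : d.Xl s < 2 - d.κ₀) : d.Xl s < d.Xl t :=
  d.Xl_lt_Xl hst ht (h1.trans_le (d.Xl_le_Xl hst.le ht)) h2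

/-- `xD_lt_top` (auxiliary). [folklore] -/
theorem xD_lt_top : d.xD < 2 - d.κ₀ := by rw [xD]; linarith [d.κ₀_lt_one, d.κD_pos]

/-- `Xl_lt_xD_of_lt_tD` (auxiliary). [folklore] -/
theorem Xl_lt_xD_of_lt_tD {t : ℝ} (ht : t < d.tD) : d.Xl t < d.xD := by
  rw [← d.Xl_tD]; exact d.Xl_lt_of_lt ht (by linarith [d.tD_lt, d.ε_pos]) (by rw [d.Xl_tD]; exact d.one_sub_κ₀_lt_xD)
    (by rw [d.Xl_tD]; exact d.xD_lt_top)

/-- `xD_lt_Xl_of_tD_lt` (auxiliary). [folklore] -/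
theorem xD_lt_Xl_of_tD_lt {t : ℝ} (ht : d.tD < t) (ht' : t ≤ d.b + d.ε) : d.xD < d.Xl t := by
  rw [← d.Xl_tD]; exact d.Xl_lt_of_gt ht ht' (by rw [d.Xl_tD]; exact d.one_sub_κ₀_lt_xD) (by rw [d.Xl_tD]; exact d.xD_lt_top)

/-- `xD_le_Xl_of_tD_le` (auxiliary). [folklore] -/
theorem xD_le_Xl_of_tD_le {t : ℝ} (ht : d.tD ≤ t) (ht' : t ≤ d.b + d.ε) : d.xD ≤ d.Xl t := by
  rcases ht.eq_or_lt with h | h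
  · rw [← h, d.Xl_tD]
  · exact (d.xD_lt_Xl_of_tD_lt h ht').le

/-- `Xl_lt_one_of_lt_tL` (auxiliary). [folklore] -/
theorem Xl_lt_one_of_lt_tL {t : ℝ} (ht : t < d.tL) : d.Xl t < 1 := by
  rw [← d.Xl_tL]; exact d.Xl_lt_of_lt ht (by linarith [d.tL_lt, d.ε_pos]) (by rw [d.Xl_tL]; linarith [d.κ₀_pos])
    (by rw [d.Xl_tL]; linarith [d.κ₀_lt_one])

/-- `one_le_Xl_of_tL_le` (auxiliary). [folklore] -/
theorem one_le_Xl_of_tL_le {t : ℝ} (ht : d.tL ≤ t) (ht' : t ≤ d.b + d.ε) : 1 ≤ d.Xl t := by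
  rcases ht.eq_or_lt with h | h
  · rw [← h, d.Xl_tL]
  · rw [← d.Xl_tL]
    exact (d.Xl_lt_of_gt h ht' (by rw [d.Xl_tL]; linarith [d.κ₀_pos]) (by rw [d.Xl_tL]; linarith [d.κ₀_lt_one])).le

/-- `Xl_le_of_le_t₂` (auxiliary). [folklore] -/
theorem Xl_le_of_le_t₂ {t : ℝ} (ht : t ≤ d.t₂) : d.Xl t ≤ 1 + 2 * d.κD := by
  rw [← d.Xl_t₂]; exact d.Xl_le_Xl ht (by linarith [d.t₂_lt, d.ε_pos])

/-- `lt_Xl_of_t₂_lt` (auxiliary). [folklore] -/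
theorem lt_Xl_of_t₂_lt {t : ℝ} (ht : d.t₂ < t) (ht' : t ≤ d.b + d.ε) : 1 + 2 * d.κD < d.Xl t := by
  rw [← d.Xl_t₂]; exact d.Xl_lt_of_gt ht ht' (by rw [d.Xl_t₂]; linarith [d.κ₀_pos, d.κD_pos])
    (by rw [d.Xl_t₂]; exact d.blend_lt_top)

/-- `tD_lt_tL` (auxiliary). [folklore] -/
theorem tD_lt_tL : d.tD < d.tL := by
  by_contra h
  have := d.Xl_le_Xl (le_of_not_gt h) (by linarith [d.tD_lt, d.ε_pos] : d.tD ≤ d.b + d.ε)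
  rw [d.Xl_tL, d.Xl_tD] at this
  linarith [d.xD_lt_one]

/-- `tL_lt_t₂` (auxiliary). [folklore] -/
theorem tL_lt_t₂ : d.tL < d.t₂ := by
  by_contra h
  have := d.Xl_le_Xl (le_of_not_gt h) (by linarith [d.tL_lt, d.ε_pos] : d.tL ≤ d.b + d.ε)
  rw [d.Xl_tL, d.Xl_t₂] at this
  linarith [d.κD_pos]

/-- From the landing time on, the guarded abscissa is `≥ 1`, so `X₁ = 1`. [folklore] -/
theorem one_le_Xg_of_tL_le {t : ℝ} (ht : d.tL ≤ t) : 1 ≤ d.Xg t := by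
  rcases le_or_gt t (d.b + d.ε) with h | h
  · exact (d.one_le_Xl_of_tL_le ht h).trans (d.Xl_le_Xg t)
  · rw [Xg, d.guard_of_ge h.le]; linarith [d.Xl_nonneg t]

/-- `X₁_of_tL_le` (auxiliary). [folklore] -/
theorem X₁_of_tL_le {t : ℝ} (ht : d.tL ≤ t) : d.X₁ t = 1 := d.X₁_eq_one_of_ge (d.one_le_Xg_of_tL_le ht)

/-- Before the landing time, `Xg = Xl < 1` and `X₁ < 1`. [folklore] -/
theorem Xg_lt_one_of_lt_tL {t : ℝ} (ht : t < d.tL) : d.Xg t < 1 := by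
  rw [d.Xg_of_le (by linarith [d.tL_lt])]; exact d.Xl_lt_one_of_lt_tL ht

/-- `X₁_lt_one_of_lt_tL` (auxiliary). [folklore] -/
theorem X₁_lt_one_of_lt_tL {t : ℝ} (ht : t < d.tL) : d.X₁ t < 1 := d.X₁_lt_one_of_Xg_lt (d.Xg_lt_one_of_lt_tL ht)

/-- Before the tip time, `Xg = Xl < x_D` and `X₁ = Xl`. [folklore] -/
theorem Xg_lt_xD_of_lt_tD {t : ℝ} (ht : t < d.tD) : d.Xg t < d.xD := by
  rw [d.Xg_of_le (by linarith [d.tD_lt])]; exact d.Xl_lt_xD_of_lt_tD ht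

/-- `X₁_eq_Xl_of_lt_tD` (auxiliary). [folklore] -/
theorem X₁_eq_Xl_of_lt_tD {t : ℝ} (ht : t < d.tD) : d.X₁ t = d.Xl t := by
  have h := d.Xg_lt_xD_of_lt_tD ht
  rw [d.X₁_eq_Xg_of_le (by rw [xD] at h; linarith [d.εℓ_lt_κD]), d.Xg_of_le (by linarith [d.tD_lt])]

/-- `X₁_lt_xD_of_lt_tD` (auxiliary). [folklore] -/
theorem X₁_lt_xD_of_lt_tD {t : ℝ} (ht : t < d.tD) : d.X₁ t < d.xD := by
  rw [d.X₁_eq_Xl_of_lt_tD ht]; exact d.Xl_lt_xD_of_lt_tD ht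

/-- `xD_le_X₁_of_tD_le` (auxiliary). [folklore] -/
theorem xD_le_X₁_of_tD_le {t : ℝ} (ht : d.tD ≤ t) : d.xD ≤ d.X₁ t := by
  rcases le_or_gt (d.Xg t) 1 with h | h
  · refine le_trans ?_ (d.Xg_le_X₁_of_le h)
    rcases le_or_gt t (d.b + d.ε) with h2 | h2
    · exact (d.xD_le_Xl_of_tD_le ht h2).trans (d.Xl_le_Xg t)
    · rw [Xg, d.guard_of_ge h2.le]; linarith [d.Xl_nonneg t, d.xD_lt_one]
  · rw [d.X₁_eq_one_of_ge h.le]; exact d.xD_lt_one.le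

/-- `x ↦ smoothMinConst 1 εℓ x` is strictly increasing on `(-∞, 1]`. [folklore] -/
theorem strictMonoOn_smoothMinConst_one : StrictMonoOn (smoothMinConst 1 d.εℓ) (Iic 1) := by
  have hε := d.εℓ_pos
  refine strictMonoOn_of_deriv_pos (convex_Iic 1) (contDiff_smoothMinConst _ _).continuous.continuousOn ?_
  intro x hx
  rw [interior_Iic] at hx
  rw [(hasDerivAt_smoothMinConst 1 d.εℓ x).deriv]
  have hS1 : smoothStep (1 - d.εℓ) 1 x < 1 := by
    rcases le_or_gt x (1 - d.εℓ) with h | h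
    · rw [smoothStep_of_le (by linarith) h]; norm_num
    · have := strictMonoOn_smoothStep (a := 1 - d.εℓ) (b := 1) (by linarith) ⟨h.le, le_of_lt hx⟩
        ⟨by linarith, le_rfl⟩ hx
      rwa [smoothStep_of_ge (by linarith) le_rfl] at this
  have hS' := deriv_smoothStep_nonneg (a := 1 - d.εℓ) (b := 1) (by linarith) x
  have hx' : 0 ≤ 1 - x := by linarith [mem_Iio.1 hx]
  nlinarith [mul_nonneg hx' hS']

/-- `Xl_le_one_of_le_tL` (auxiliary). [folklore] -/
theorem Xl_le_one_of_le_tL {t : ℝ} (ht : t ≤ d.tL) : d.Xl t ≤ 1 := by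
  rcases ht.eq_or_lt with h | h
  · rw [h, d.Xl_tL]
  · exact (d.Xl_lt_one_of_lt_tL h).le

/-- **The abscissa is strictly increasing on `[t_D, t_L]`.** [folklore] -/
theorem strictMonoOn_X₁ : StrictMonoOn d.X₁ (Icc d.tD d.tL) := by
  intro s hs t ht hst
  have htb : t ≤ d.b + d.ε := by linarith [ht.2, d.tL_lt, d.ε_pos]
  have hXs : d.Xl s ≤ 1 := d.Xl_le_one_of_le_tL hs.2
  have hXt : d.Xl t ≤ 1 := d.Xl_le_one_of_le_tL ht.2
  have h1 : d.Xl s < d.Xl t := d.Xl_lt_Xl hst htb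
    (d.one_sub_κ₀_lt_xD.trans_le (d.xD_le_Xl_of_tD_le ht.1 htb)) (by linarith [d.κ₀_lt_one])
  have hsg : d.Xg s = d.Xl s := d.Xg_of_le (by linarith [hs.2, d.tL_lt])
  have htg : d.Xg t = d.Xl t := d.Xg_of_le (by linarith [ht.2, d.tL_lt])
  show smoothMinConst 1 d.εℓ (d.Xg s) < smoothMinConst 1 d.εℓ (d.Xg t)
  rw [hsg, htg]
  exact d.strictMonoOn_smoothMinConst_one (show d.Xl s ∈ Iic (1:ℝ) from hXs) (show d.Xl t ∈ Iic (1:ℝ) from hXt) h1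

/-! ### The smoothed positive part `ζ` -/

/-- `ζ_of_nonpos` (auxiliary). [folklore] -/
theorem ζ_of_nonpos {u : ℝ} (hu : u ≤ 0) : d.ζ u = 0 := by
  rw [ζ, smoothStep_of_le d.u₁_pos hu, mul_zero]

/-- `ζ_nonneg` (auxiliary). [folklore] -/
theorem ζ_nonneg (u : ℝ) : 0 ≤ d.ζ u := by
  rcases le_or_gt u 0 with h | h
  · rw [d.ζ_of_nonpos h]
  · exact mul_nonneg h.le (smoothStep_mem_Icc _ _ _).1

/-- `ζ_le_self` (auxiliary). [folklore] -/
theorem ζ_le_self {u : ℝ} (hu : 0 ≤ u) : d.ζ u ≤ u := by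
  rw [ζ]; have := (smoothStep_mem_Icc 0 d.u₁ u).2; nlinarith

/-- `ζ_le_max` (auxiliary). [folklore] -/
theorem ζ_le_max (u : ℝ) : d.ζ u ≤ max u 0 := by
  rcases le_or_gt u 0 with h | h
  · rw [d.ζ_of_nonpos h]; exact le_max_right _ _
  · exact (d.ζ_le_self h.le).trans (le_max_left _ _)

/-- `hasDerivAt_ζ` (auxiliary). [folklore] -/
theorem hasDerivAt_ζ (u : ℝ) :
    HasDerivAt d.ζ (smoothStep 0 d.u₁ u + u * deriv (smoothStep 0 d.u₁) u) u := by
  have hS : HasDerivAt (smoothStep 0 d.u₁) (deriv (smoothStep 0 d.u₁) u) u :=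
    ((contDiff_smoothStep _ _).differentiable (by simp) u).hasDerivAt
  have h := (hasDerivAt_id u).mul hS
  have e : d.ζ = fun x ↦ id x * smoothStep 0 d.u₁ x := rfl
  rw [e]
  refine (h.congr_of_eventuallyEq (Eventually.of_forall fun s ↦ rfl)).congr_deriv ?_
  simp only [id, one_mul]

/-- `deriv_ζ_nonneg` (auxiliary). [folklore] -/
theorem deriv_ζ_nonneg (u : ℝ) : 0 ≤ deriv d.ζ u := by
  rw [(d.hasDerivAt_ζ u).deriv]
  have h1 := (smoothStep_mem_Icc 0 d.u₁ u).1
  rcases le_or_gt u 0 with h | h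
  · rcases h.eq_or_lt with h' | h'
    · rw [h', deriv_smoothStep_left]; simp [smoothStep_of_le d.u₁_pos le_rfl]
    · rw [deriv_smoothStep_of_lt d.u₁_pos h', smoothStep_of_le d.u₁_pos h]; simp
  · exact add_nonneg h1 (mul_nonneg h.le (deriv_smoothStep_nonneg d.u₁_pos u))

/-- Past the bend width the smoothed positive part has slope `1`. [folklore] -/
theorem deriv_ζ_of_ge {u : ℝ} (hu : d.u₁ ≤ u) : deriv d.ζ u = 1 := by
  rw [(d.hasDerivAt_ζ u).deriv, smoothStep_of_ge d.u₁_pos hu]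
  rcases hu.eq_or_lt with h | h
  · rw [← h, deriv_smoothStep_right d.u₁_pos]; ring
  · rw [deriv_smoothStep_of_gt d.u₁_pos h]; ring

/-- `ζ_eventuallyEq_zero` (auxiliary). [folklore] -/
theorem ζ_eventuallyEq_zero {u : ℝ} (hu : u < 0) : d.ζ =ᶠ[𝓝 u] fun _ ↦ (0 : ℝ) :=
  Filter.eventuallyEq_of_mem (Iio_mem_nhds hu) fun _ hs ↦ d.ζ_of_nonpos (le_of_lt hs)

/-! ### The bent virtual height `P` -/

/-- `hasDerivAt_P` (auxiliary). [folklore] -/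
theorem hasDerivAt_P (t : ℝ) :
    HasDerivAt d.P (deriv d.Hh t - d.ms * (deriv d.ζ (d.Xg t - d.xD) * deriv d.Xg t)) t := by
  have hX : HasDerivAt (fun t ↦ d.Xg t - d.xD) (deriv d.Xg t) t := by
    simpa using ((d.contDiff_Xg.differentiable (by simp) t).hasDerivAt).sub_const d.xD
  have hζ : HasDerivAt d.ζ (deriv d.ζ (d.Xg t - d.xD)) (d.Xg t - d.xD) :=
    (d.contDiff_ζ.differentiable (by simp) _).hasDerivAt
  have hcomp := hζ.comp t hX
  have hH : HasDerivAt d.Hh (deriv d.Hh t) t := (d.contDiff_Hh.differentiable (by simp) t).hasDerivAt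
  exact hH.sub (hcomp.const_mul d.ms)

/-- `P_le_Hh` (auxiliary). [folklore] -/
theorem P_le_Hh (t : ℝ) : d.P t ≤ d.Hh t := by
  rw [P]; nlinarith [mul_nonneg d.ms_pos.le (d.ζ_nonneg (d.Xg t - d.xD))]

/-- `P_le` (auxiliary). [folklore] -/
theorem P_le (t : ℝ) : d.P t ≤ d.f t + d.ch := (d.P_le_Hh t).trans (d.Hh_le t)

/-- Where the guarded abscissa is below the tip value, `P = Hh`. [folklore] -/
theorem P_of_Xg_le {t : ℝ} (ht : d.Xg t ≤ d.xD) : d.P t = d.Hh t := by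
  rw [P, d.ζ_of_nonpos (by linarith), mul_zero, sub_zero]

/-- `P ≥ Hh - 3 m_s κ_D` as long as the final blend is not complete (`Xg ≤ 1 + 2κ_D`). [folklore] -/
theorem P_ge {t : ℝ} (hX : d.Xg t ≤ 1 + 2 * d.κD) : d.Hh t - 3 * d.ms * d.κD ≤ d.P t := by
  have hζ : d.ζ (d.Xg t - d.xD) ≤ 3 * d.κD := by
    refine (d.ζ_le_max _).trans (max_le ?_ (by linarith [d.κD_pos]))
    rw [xD]; linarith
  rw [P]; nlinarith [mul_le_mul_of_nonneg_left hζ d.ms_pos.le]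

/-- **On the landing heights the bent height stays above `g`.** [folklore] -/
theorem g_lt_P {t : ℝ} (ht : t ∈ Icc (d.b - d.ε) (d.b + d.ε)) (h1 : 1 - d.κ₀ < d.Xl t)
    (hX : d.Xg t ≤ 1 + 2 * d.κD) : d.g t < d.P t := by
  have hHh : d.hr0 < d.Hh t := d.hr0_lt_of_lt_ρt h1
  have := d.gap t ht
  linarith [d.P_ge hX]

/-- **On `[t_L, t₂]` the bent height strictly decreases**: `P' ≤ -MH < 0`. [folklore] -/
theorem deriv_P_neg {t : ℝ} (ht : t ∈ Icc d.tL d.t₂) : deriv d.P t < 0 := by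
  have htL := d.tL_mem; have ht₂ := d.t₂_mem
  have hwin : t ∈ Icc (d.b - d.ε) (d.b - d.ε / 2) := ⟨by linarith [htL.1, ht.1], by linarith [ht₂.2, ht.2]⟩
  have htb : t ≤ d.b + d.ε := by linarith [hwin.2, d.ε_pos]
  have hlt : t < d.b + d.ε / 2 := by linarith [hwin.2, d.ε_pos]
  have hXl1 : 1 ≤ d.Xl t := d.one_le_Xl_of_tL_le ht.1 htb
  have hXl2 : d.Xl t ≤ 1 + 2 * d.κD := d.Xl_le_of_le_t₂ ht.2
  have hXg : d.Xg t = d.Xl t := d.Xg_of_le hlt.le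
  -- the landing step reads `Sr (Hh t) = Xl t - (1 - κ₀) ∈ [κ₀, κ₀ + 2κ_D]`
  have hρ : d.ρt (d.Hh t) = 1 - d.κ₀ + d.Sr (d.Hh t) := d.ρt_eq_of_lt_ρt (by
    show 1 - d.κ₀ < d.Xl t; linarith [d.κ₀_pos])
  have hSr : d.Sr (d.Hh t) ∈ Icc (d.κ₀ - 3 * d.κD) (d.κ₀ + 3 * d.κD) := by
    have e : d.Sr (d.Hh t) = d.Xl t - (1 - d.κ₀) := by show _ = d.ρt (d.Hh t) - _; rw [hρ]; ring
    rw [e]; constructor <;> linarith [d.κD_pos]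
  have hX' : d.vmin ≤ deriv d.Xg t := by rw [d.deriv_Xg_of_lt hlt]; exact d.vmin_le_deriv_Xl hwin hSr
  have hζ' : deriv d.ζ (d.Xg t - d.xD) = 1 := d.deriv_ζ_of_ge (by rw [hXg, xD]; linarith [d.u₁_le])
  have hH' : deriv d.Hh t ≤ d.MH := d.deriv_Hh_le_MH ⟨hwin.1, htb⟩
  rw [(d.hasDerivAt_P t).deriv, hζ', one_mul]
  nlinarith [d.ms_large, d.MH_pos, mul_le_mul_of_nonneg_left hX' d.ms_pos.le]

/-! ### The blend parameter `S₂` and the height `H₁` -/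

/-- `S₂_mem_Icc` (auxiliary). [folklore] -/
theorem S₂_mem_Icc (t : ℝ) : d.S₂ t ∈ Icc (0 : ℝ) 1 := smoothStep_mem_Icc _ _ _
/-- `S₂_lt'` (auxiliary). [folklore] -/
theorem S₂_lt' : 1 + d.κD < 1 + 2 * d.κD := by linarith [d.κD_pos]
/-- `S₂_of_le` (auxiliary). [folklore] -/
theorem S₂_of_le {t : ℝ} (ht : d.Xg t ≤ 1 + d.κD) : d.S₂ t = 0 := smoothStep_of_le d.S₂_lt' ht
/-- `S₂_of_ge` (auxiliary). [folklore] -/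
theorem S₂_of_ge {t : ℝ} (ht : 1 + 2 * d.κD ≤ d.Xg t) : d.S₂ t = 1 := smoothStep_of_ge d.S₂_lt' ht

/-- From `b - ε/2` on the blend is complete. [folklore] -/
theorem S₂_of_ge' {t : ℝ} (ht : d.b - d.ε / 2 ≤ t) : d.S₂ t = 1 :=
  d.S₂_of_ge (by linarith [d.le_Xg_of_ge ht, d.blend_lt_top])

/-- `S₂ t < 1` forces `t ≤ t₂` (indeed `Xg t < 1 + 2κ_D`). [folklore] -/
theorem Xg_lt_of_S₂_lt_one {t : ℝ} (h : d.S₂ t < 1) : d.Xg t < 1 + 2 * d.κD := by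
  by_contra h2; exact h.ne (d.S₂_of_ge (le_of_not_gt h2))

/-- `le_t₂_of_Xg_le` (auxiliary). [folklore] -/
theorem le_t₂_of_Xg_le {t : ℝ} (hX : d.Xg t ≤ 1 + 2 * d.κD) : t ≤ d.t₂ := by
  by_contra h
  have hlt : d.t₂ < t := lt_of_not_ge h
  have htb : t < d.b - d.ε / 2 := by
    by_contra h2
    have := d.le_Xg_of_ge (le_of_not_gt h2)
    linarith [d.blend_lt_top]
  have := d.lt_Xl_of_t₂_lt hlt (by linarith [d.ε_pos])
  rw [← d.Xg_of_le (by linarith [d.ε_pos])] at this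
  linarith

/-- `0 < S₂ t` forces `t_L < t`... at least `b - ε < t` and `1 < Xg t`. [folklore] -/
theorem lt_of_S₂_pos {t : ℝ} (h : 0 < d.S₂ t) : 1 + d.κD < d.Xg t := by
  by_contra h2; rw [d.S₂_of_le (le_of_not_gt h2)] at h; exact lt_irrefl _ h

/-- `gt_window_of_Xg_gt` (auxiliary). [folklore] -/
theorem gt_window_of_Xg_gt {t : ℝ} (h : 1 - d.κ₀ < d.Xg t) : d.b - d.ε < t := by
  by_contra h2; exact lt_irrefl _ (h.trans_le (d.Xg_le_of_le (le_of_not_gt h2)))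

/-- `hasDerivAt_S₂` (auxiliary). [folklore] -/
theorem hasDerivAt_S₂ (t : ℝ) :
    HasDerivAt d.S₂ (deriv (smoothStep (1 + d.κD) (1 + 2 * d.κD)) (d.Xg t) * deriv d.Xg t) t := by
  have hS : HasDerivAt (smoothStep (1 + d.κD) (1 + 2 * d.κD))
      (deriv (smoothStep (1 + d.κD) (1 + 2 * d.κD)) (d.Xg t)) (d.Xg t) :=
    ((contDiff_smoothStep _ _).differentiable (by simp) _).hasDerivAt
  exact hS.comp t (d.contDiff_Xg.differentiable (by simp) t).hasDerivAt

/-- `deriv_S₂_nonneg` (auxiliary). [folklore] -/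
theorem deriv_S₂_nonneg {t : ℝ} (ht : t ≤ d.b + d.ε) : 0 ≤ deriv d.S₂ t := by
  rw [(d.hasDerivAt_S₂ t).deriv]
  exact mul_nonneg (deriv_smoothStep_nonneg d.S₂_lt' _) (d.deriv_Xg_nonneg ht)

/-- `H₁_of_S₂_zero` (auxiliary). [folklore] -/
theorem H₁_of_S₂_zero {t : ℝ} (ht : d.S₂ t = 0) : d.H₁ t = d.P t := by rw [H₁, ht]; ring

/-- **From `b - ε/2` on the height is `g`.** [folklore] -/
theorem H₁_of_ge {t : ℝ} (ht : d.b - d.ε / 2 ≤ t) : d.H₁ t = d.g t := by rw [H₁, d.S₂_of_ge' ht]; ring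

/-- Near any `t` with `Xg t < x_D` the height is the virtual height `Hh`. [folklore] -/
theorem H₁_eventuallyEq_Hh {t : ℝ} (ht : d.Xg t < d.xD) : d.H₁ =ᶠ[𝓝 t] d.Hh := by
  have ho : IsOpen {s | d.Xg s < d.xD} := isOpen_lt d.contDiff_Xg.continuous continuous_const
  filter_upwards [ho.mem_nhds ht] with s hs
  have hs' : d.Xg s < d.xD := hs
  rw [d.H₁_of_S₂_zero (d.S₂_of_le (by rw [xD] at hs'; linarith [d.κD_pos])), d.P_of_Xg_le hs'.le]

/-- **Before the tip time the height is the virtual height** (in particular `H₁ = Hh` on the rise,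
and `H₁ = f` up to `a`). [folklore] -/
theorem H₁_of_lt_tD {t : ℝ} (ht : t < d.tD) : d.H₁ t = d.Hh t := (d.H₁_eventuallyEq_Hh (d.Xg_lt_xD_of_lt_tD ht)).eq_of_nhds

/-- `H₁_of_le_a` (auxiliary). [folklore] -/
theorem H₁_of_le_a {t : ℝ} (ht : t ≤ d.a) : d.H₁ t = d.f t := by
  rw [d.H₁_of_lt_tD (ht.trans_lt d.a_lt_tD), d.Hh_of_le (by linarith [d.hab, d.ε_pos])]

/-- `deriv_H₁_of_lt_tD` (auxiliary). [folklore] -/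
theorem deriv_H₁_of_lt_tD {t : ℝ} (ht : t < d.tD) : deriv d.H₁ t = deriv d.Hh t :=
  (d.H₁_eventuallyEq_Hh (d.Xg_lt_xD_of_lt_tD ht)).deriv_eq

/-- `deriv_H₁_pos_of_lt_tD` (auxiliary). [folklore] -/
theorem deriv_H₁_pos_of_lt_tD {t : ℝ} (ht : t < d.tD) : 0 < deriv d.H₁ t := by
  rw [d.deriv_H₁_of_lt_tD ht]; exact d.deriv_Hh_pos (by linarith [d.tD_lt, d.ε_pos])

/-- The height is strictly increasing up to the tip time. [folklore] -/
theorem strictMonoOn_H₁_rise : StrictMonoOn d.H₁ (Iio d.tD) := by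
  refine strictMonoOn_of_deriv_pos (convex_Iio _) d.contDiff_H₁.continuous.continuousOn fun x hx ↦ ?_
  rw [interior_Iio] at hx
  exact d.deriv_H₁_pos_of_lt_tD hx

/-- `hasDerivAt_H₁` (auxiliary). [folklore] -/
theorem hasDerivAt_H₁ (t : ℝ) :
    HasDerivAt d.H₁ ((1 - d.S₂ t) * deriv d.P t + d.S₂ t * deriv d.g t +
      deriv d.S₂ t * (d.g t - d.P t)) t := by
  have hS : HasDerivAt d.S₂ (deriv d.S₂ t) t := (d.contDiff_S₂.differentiable (by simp) t).hasDerivAt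
  have hP : HasDerivAt d.P (deriv d.P t) t := (d.contDiff_P.differentiable (by simp) t).hasDerivAt
  have hg : HasDerivAt d.g (deriv d.g t) t := (d.g_smooth.differentiable (by simp) t).hasDerivAt
  have h := (((hasDerivAt_const t (1 : ℝ)).sub hS).mul hP).add (hS.mul hg)
  refine (h.congr_of_eventuallyEq (Eventually.of_forall fun s ↦ rfl)).congr_deriv ?_
  simp only [Pi.sub_apply]
  ring

/-- `H₁_eventuallyEq_g` (auxiliary). [folklore] -/
theorem H₁_eventuallyEq_g {t : ℝ} (ht : 1 + 2 * d.κD < d.Xg t) : d.H₁ =ᶠ[𝓝 t] d.g := by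
  have ho : IsOpen {s | 1 + 2 * d.κD < d.Xg s} := isOpen_lt continuous_const d.contDiff_Xg.continuous
  filter_upwards [ho.mem_nhds ht] with s hs
  rw [H₁, d.S₂_of_ge (le_of_lt hs)]; ring

/-- **From the landing time on the height strictly decreases** (through `b + ε`). [folklore] -/
theorem deriv_H₁_neg {t : ℝ} (ht : t ∈ Icc d.tL (d.b + d.ε)) : deriv d.H₁ t < 0 := by
  have htL := d.tL_mem
  have hg' : deriv d.g t < 0 := d.g_deriv_neg t (by linarith [htL.1, ht.1])
  rcases lt_or_ge (1 + 2 * d.κD) (d.Xg t) with hX | hX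
  · rw [(d.H₁_eventuallyEq_g hX).deriv_eq]; exact hg'
  · have ht₂ : t ≤ d.t₂ := d.le_t₂_of_Xg_le hX
    have hP' := d.deriv_P_neg ⟨ht.1, ht₂⟩
    have hlt : t < d.b + d.ε / 2 := ht₂.trans_lt d.t₂_lt
    have hgP : d.g t < d.P t := d.g_lt_P ⟨by linarith [htL.1, ht.1], ht.2⟩
      (by linarith [d.one_le_Xl_of_tL_le ht.1 ht.2, d.κ₀_pos]) hX
    have hS := d.S₂_mem_Icc t
    have hS' := d.deriv_S₂_nonneg ht.2
    rw [(d.hasDerivAt_H₁ t).deriv]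
    nlinarith [mul_nonneg hS' (sub_nonneg.2 hgP.le), mul_nonneg hS.1 (neg_nonneg.2 hg'.le),
      mul_nonneg (sub_nonneg.2 hS.2) (neg_nonneg.2 hP'.le)]

/-- `H₁` is strictly decreasing on `[t_L, b + ε]`. [folklore] -/
theorem strictAntiOn_H₁ : StrictAntiOn d.H₁ (Icc d.tL (d.b + d.ε)) := by
  refine strictAntiOn_of_deriv_neg (convex_Icc _ _) d.contDiff_H₁.continuous.continuousOn fun x hx ↦ ?_
  rw [interior_Icc] at hx
  exact d.deriv_H₁_neg ⟨hx.1.le, hx.2.le⟩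

/-! ### The height bounds -/

/-- **The height lies in `(1/10, 1/2)` on the inner interval.** [folklore] -/
theorem H₁_mem_Ioo {t : ℝ} (ht : t ∈ Icc (d.a - d.ε / 2) (d.b + 3 * d.ε / 4)) :
    d.H₁ t ∈ Ioo (10⁻¹ : ℝ) 2⁻¹ := by
  have htb : t ≤ d.b + d.ε := by linarith [ht.2, d.ε_pos]
  have hPup : d.P t < 2⁻¹ := (d.P_le t).trans_lt (d.f_hi t ⟨ht.1, htb⟩)
  have hS := d.S₂_mem_Icc t
  -- lower bound for `P` whenever the blend is incomplete
  have hPlo : d.S₂ t < 1 → 10⁻¹ < d.P t := by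
    intro hS1
    have hX : d.Xg t < 1 + 2 * d.κD := d.Xg_lt_of_S₂_lt_one hS1
    rcases le_or_gt (d.Xg t) d.xD with h | h
    · rw [d.P_of_Xg_le h]; exact (d.f_lo t ⟨ht.1, htb⟩).trans_le (d.f_le_Hh t)
    · have hκ : 1 - d.κ₀ < d.Xg t := d.one_sub_κ₀_lt_xD.trans h
      have htw : d.b - d.ε < t := d.gt_window_of_Xg_gt hκ
      have ht₂ := d.le_t₂_of_Xg_le hX.le
      have hXl : 1 - d.κ₀ < d.Xl t := by rwa [d.Xg_of_le (ht₂.trans d.t₂_lt.le)] at hκ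
      exact (d.g_mem t ⟨htw.le, htb⟩).1.trans (d.g_lt_P ⟨htw.le, htb⟩ hXl hX.le)
  -- `g` is in the window whenever the blend has started
  have hgw : 0 < d.S₂ t → d.g t ∈ Ioo (10⁻¹ : ℝ) 2⁻¹ := fun h0 ↦
    d.g_mem t ⟨(d.gt_window_of_Xg_gt (by linarith [d.lt_of_S₂_pos h0, d.κ₀_pos, d.κD_pos])).le, htb⟩
  rcases hS.2.eq_or_lt with h1 | h1
  · have hH : d.H₁ t = d.g t := by rw [H₁, h1]; ring
    rw [hH]; exact hgw (by rw [h1]; exact one_pos)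
  · have hP := hPlo h1
    rcases hS.1.eq_or_lt with h0 | h0
    · rw [d.H₁_of_S₂_zero h0.symm]; exact ⟨hP, hPup⟩
    · have hg := hgw h0
      rw [H₁]
      constructor <;> nlinarith [hg.1, hg.2, hS.1, hS.2]

/-- **On the landing window, where the abscissa is `1` the height is `≥ g`.** [folklore] -/
theorem g_le_H₁ {t : ℝ} (ht : t ∈ Icc (d.b - d.ε) (d.b + 3 * d.ε / 4)) (hX : d.X₁ t = 1) :
    d.g t ≤ d.H₁ t := by
  have htb : t ≤ d.b + d.ε := by linarith [ht.2, d.ε_pos]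
  have hS := d.S₂_mem_Icc t
  have htL : d.tL ≤ t := by
    by_contra h; exact (d.X₁_lt_one_of_lt_tL (lt_of_not_ge h)).ne hX
  rcases le_or_gt (d.Xg t) (1 + 2 * d.κD) with h | h
  · have hgP := d.g_lt_P ⟨ht.1, htb⟩ (by linarith [d.one_le_Xl_of_tL_le htL htb, d.κ₀_pos]) h
    rw [H₁]; nlinarith [hS.1, hS.2]
  · rw [H₁, d.S₂_of_ge h.le]; linarith

/-! ### Injectivity, regularity, co-monotonicity -/

/-- **The track is injective on the inner interval.** [folklore] -/
theorem injOn_track : InjOn (fun t ↦ (d.X₁ t, d.H₁ t)) (Icc (d.a - d.ε / 2) (d.b + 3 * d.ε / 4)) := by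
  have key : ∀ s ∈ Icc (d.a - d.ε / 2) (d.b + 3 * d.ε / 4), ∀ t ∈ Icc (d.a - d.ε / 2) (d.b + 3 * d.ε / 4),
      s < t → (d.X₁ s, d.H₁ s) ≠ (d.X₁ t, d.H₁ t) := by
    intro s hs t ht hst heq
    have hX : d.X₁ s = d.X₁ t := congrArg Prod.fst heq
    have hH : d.H₁ s = d.H₁ t := congrArg Prod.snd heq
    rcases lt_or_ge t d.tD with htD | htD
    · -- both before the tip: heights strictly increase
      exact (d.strictMonoOn_H₁_rise (show s ∈ Iio d.tD from hst.trans htD) (show t ∈ Iio d.tD from htD) hst).ne hH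
    · rcases lt_or_ge t d.tL with htL | htL
      · -- `t ∈ [t_D, t_L)`: `X₁ t ≥ x_D`; `s` before the tip has `X₁ s < x_D`, else strict monotonicity
        rcases lt_or_ge s d.tD with hsD | hsD
        · exact ((d.X₁_lt_xD_of_lt_tD hsD).trans_le (d.xD_le_X₁_of_tD_le htD)).ne hX
        · exact (d.strictMonoOn_X₁ ⟨hsD, (hst.trans htL).le⟩ ⟨htD, htL.le⟩ hst).ne hX
      · -- `t ≥ t_L`: `X₁ t = 1`, so `X₁ s = 1`, so `s ≥ t_L`, and heights strictly decrease
        rw [d.X₁_of_tL_le htL] at hX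
        have hsL : d.tL ≤ s := by
          by_contra h; exact (d.X₁_lt_one_of_lt_tL (lt_of_not_ge h)).ne hX
        have h1 := d.strictAntiOn_H₁ ⟨hsL, by linarith [hs.2, d.ε_pos]⟩ ⟨htL, by linarith [ht.2, d.ε_pos]⟩ hst
        exact h1.ne' hH
  intro s hs t ht heq
  rcases lt_trichotomy s t with h | h | h
  · exact absurd heq (key s hs t ht h)
  · exact h
  · exact absurd heq.symm (key t ht s hs h)

/-- On `[t_D, t_L)` the abscissa has positive derivative. [folklore] -/
theorem deriv_X₁_pos {t : ℝ} (ht : t ∈ Ico d.tD d.tL) : 0 < deriv d.X₁ t := by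
  have htD := d.tD_mem; have htL := d.tL_mem
  have hwin : t ∈ Icc (d.b - d.ε) (d.b - d.ε / 2) := ⟨by linarith [htD.1, ht.1], by linarith [htL.2, ht.2]⟩
  have htb : t ≤ d.b + d.ε := by linarith [hwin.2, d.ε_pos]
  have hlt : t < d.b + d.ε / 2 := by linarith [hwin.2, d.ε_pos]
  have hXg : d.Xg t = d.Xl t := d.Xg_of_le hlt.le
  have hXl1 : d.Xl t < 1 := d.Xl_lt_one_of_lt_tL ht.2
  have hXlD : d.xD ≤ d.Xl t := d.xD_le_Xl_of_tD_le ht.1 htb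
  -- `Sr (Hh t) = Xl t - (1 - κ₀) ∈ [κ₀ - κ_D, κ₀]`
  have hρ : d.ρt (d.Hh t) = 1 - d.κ₀ + d.Sr (d.Hh t) :=
    d.ρt_eq_of_lt_ρt (show 1 - d.κ₀ < d.Xl t from d.one_sub_κ₀_lt_xD.trans_le hXlD)
  have hSr : d.Sr (d.Hh t) ∈ Icc (d.κ₀ - 3 * d.κD) (d.κ₀ + 3 * d.κD) := by
    have e : d.Sr (d.Hh t) = d.Xl t - (1 - d.κ₀) := by show _ = d.ρt (d.Hh t) - _; rw [hρ]; ring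
    rw [e]; rw [xD] at hXlD; constructor <;> linarith [d.κD_pos]
  have hXl' : 0 < deriv d.Xl t := d.vmin_pos.trans_le (d.vmin_le_deriv_Xl hwin hSr)
  have hXg' : 0 < deriv d.Xg t := by rwa [d.deriv_Xg_of_lt hlt]
  have hmin' : 0 < deriv (smoothMinConst 1 d.εℓ) (d.Xg t) := by
    rw [hXg, (hasDerivAt_smoothMinConst 1 d.εℓ (d.Xl t)).deriv]
    have hS1 : smoothStep (1 - d.εℓ) 1 (d.Xl t) < 1 := by
      rcases le_or_gt (d.Xl t) (1 - d.εℓ) with h | h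
      · rw [smoothStep_of_le (by linarith [d.εℓ_pos]) h]; norm_num
      · have := strictMonoOn_smoothStep (a := 1 - d.εℓ) (b := 1) (by linarith [d.εℓ_pos]) ⟨h.le, hXl1.le⟩
          ⟨by linarith [d.εℓ_pos], le_rfl⟩ hXl1
        rwa [smoothStep_of_ge (by linarith [d.εℓ_pos]) le_rfl] at this
    have hS' := deriv_smoothStep_nonneg (a := 1 - d.εℓ) (b := 1) (by linarith [d.εℓ_pos]) (d.Xl t)
    nlinarith [mul_nonneg (sub_nonneg.2 hXl1.le) hS']
  have hc : HasDerivAt d.X₁ (deriv (smoothMinConst 1 d.εℓ) (d.Xg t) * deriv d.Xg t) t :=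
    ((contDiff_smoothMinConst 1 d.εℓ).differentiable (by simp) _).hasDerivAt.comp t
      (d.contDiff_Xg.differentiable (by simp) t).hasDerivAt
  rw [hc.deriv]
  exact mul_pos hmin' hXg'

/-- **Regularity**: where `X₁' = 0` on the inner interval, `H₁' ≠ 0`. [folklore] -/
theorem deriv_H₁_ne_zero {s : ℝ} (hs : s ∈ Icc (d.a - d.ε / 2) (d.b + 3 * d.ε / 4))
    (hX : deriv d.X₁ s = 0) : deriv d.H₁ s ≠ 0 := by
  rcases lt_or_ge s d.tD with hsD | hsD
  · exact (d.deriv_H₁_pos_of_lt_tD hsD).ne'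
  · rcases lt_or_ge s d.tL with hsL | hsL
    · exact absurd hX (d.deriv_X₁_pos ⟨hsD, hsL⟩).ne'
    · exact (d.deriv_H₁_neg ⟨hsL, by linarith [hs.2, d.ε_pos]⟩).ne

/-- `v_eventuallyEq_f` (auxiliary). [folklore] -/
theorem v_eventuallyEq_f {s : ℝ} (hs : s < d.a + d.ε) : d.v =ᶠ[𝓝 s] d.f := by
  filter_upwards [Iio_mem_nhds hs] with t ht
  rw [v, smoothStep_of_le d.hab (le_of_lt ht)]; ring

/-- `v_eventuallyEq_g` (auxiliary). [folklore] -/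
theorem v_eventuallyEq_g {s : ℝ} (hs : d.b - d.ε < s) : d.v =ᶠ[𝓝 s] d.g := by
  filter_upwards [Ioi_mem_nhds hs] with t ht
  rw [v, smoothStep_of_ge d.hab (le_of_lt ht)]; ring

/-- `v_of_le` (auxiliary). [folklore] -/
theorem v_of_le {t : ℝ} (ht : t ≤ d.a + d.ε) : d.v t = d.f t := by rw [v, smoothStep_of_le d.hab ht]; ring

/-- `v_of_ge` (auxiliary). [folklore] -/
theorem v_of_ge {t : ℝ} (ht : d.b - d.ε ≤ t) : d.v t = d.g t := by rw [v, smoothStep_of_ge d.hab ht]; ring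

/-- Equal arch abscissae at `s < t` force `t ≤ a` or `b ≤ s`. [folklore] -/
theorem le_or_le_of_χ_eq {s t : ℝ} (hst : s < t) (h : smoothStep d.a d.b s = smoothStep d.a d.b t) :
    t ≤ d.a ∨ d.b ≤ s := by
  by_cases hta' : t ≤ d.a
  · exact Or.inl hta'
  by_cases hsb' : d.b ≤ s
  · exact Or.inr hsb'
  have hta : d.a < t := lt_of_not_ge hta'
  have hsb : s < d.b := lt_of_not_ge hsb'
  exfalso
  have hm := strictMonoOn_smoothStep d.a_lt_b
  have h1 : smoothStep d.a d.b s < smoothStep d.a d.b t := by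
    rcases le_or_gt s d.a with hsa | hsa
    · rw [smoothStep_of_le d.a_lt_b hsa]
      rcases le_or_gt t d.b with htb | htb
      · have := hm ⟨le_rfl, d.a_lt_b.le⟩ ⟨hta.le, htb⟩ hta; rwa [smoothStep_of_le d.a_lt_b le_rfl] at this
      · rw [smoothStep_of_ge d.a_lt_b htb.le]; exact one_pos
    · rcases le_or_gt t d.b with htb | htb
      · exact hm ⟨hsa.le, hsb.le⟩ ⟨hta.le, htb⟩ hst
      · rw [smoothStep_of_ge d.a_lt_b htb.le]
        have := hm ⟨hsa.le, hsb.le⟩ ⟨d.a_lt_b.le, le_rfl⟩ hsb; rwa [smoothStep_of_ge d.a_lt_b le_rfl] at this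
  exact h1.ne h

/-- `tL_lt_b` (auxiliary). [folklore] -/
theorem tL_lt_b : d.tL < d.b := by linarith [d.tL_mem.2, d.ε_pos]

/-- **Co-monotonicity with the arch on the common abscissa plateaux.** [folklore] -/
theorem co_mono {s : ℝ} (hs : s ∈ Icc (d.a - d.ε / 2) (d.b + 3 * d.ε / 4)) {t : ℝ}
    (ht : t ∈ Icc (d.a - d.ε / 2) (d.b + 3 * d.ε / 4)) (hst : s < t)
    (hχ : smoothStep d.a d.b s = smoothStep d.a d.b t) :
    (d.v s < d.v t ∧ d.H₁ s < d.H₁ t) ∨ (d.v t < d.v s ∧ d.H₁ t < d.H₁ s) := by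
  rcases d.le_or_le_of_χ_eq hst hχ with hta | hsb
  · left
    have hsa : s ≤ d.a := hst.le.trans hta
    rw [d.v_of_le (by linarith [d.ε_pos]), d.v_of_le (by linarith [d.ε_pos]), d.H₁_of_le_a hsa, d.H₁_of_le_a hta]
    have h1 := d.f_lt_f hst (by linarith [d.hab, d.ε_pos])
    exact ⟨h1, h1⟩
  · right
    rw [d.v_of_ge (by linarith [d.ε_pos]), d.v_of_ge (by linarith [d.ε_pos])]
    have h1 := d.strictAntiOn_g (show s ∈ Ici (d.b - d.ε) by simp only [mem_Ici]; linarith [d.ε_pos])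
      (show t ∈ Ici (d.b - d.ε) by simp only [mem_Ici]; linarith [d.ε_pos]) hst
    have h2 := d.strictAntiOn_H₁ ⟨d.tL_lt_b.le.trans hsb, by linarith [hs.2, d.ε_pos]⟩
      ⟨d.tL_lt_b.le.trans (hsb.trans hst.le), by linarith [ht.2, d.ε_pos]⟩ hst
    exact ⟨h1, h2⟩

/-- **Co-monotonicity of the derivatives on the common abscissa plateaux.** [folklore] -/
theorem co_monoD {s : ℝ} (hs : s ∈ Icc (d.a - d.ε / 2) (d.b + 3 * d.ε / 4))
    (hχ : deriv (smoothStep d.a d.b) s = 0) : 0 < deriv d.v s * deriv d.H₁ s := by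
  have hs' : s ≤ d.a ∨ d.b ≤ s := by
    by_cases h1 : s ≤ d.a
    · exact Or.inl h1
    by_cases h2 : d.b ≤ s
    · exact Or.inr h2
    exact absurd hχ (deriv_smoothStep_pos d.a_lt_b ⟨lt_of_not_ge h1, lt_of_not_ge h2⟩).ne'
  rcases hs' with hsa | hsb
  · rw [(d.v_eventuallyEq_f (by linarith [d.ε_pos])).deriv_eq]
    exact mul_pos (d.f_deriv_pos s (by linarith [d.hab, d.ε_pos])) (d.deriv_H₁_pos_of_lt_tD (hsa.trans_lt d.a_lt_tD))
  · rw [(d.v_eventuallyEq_g (by linarith [d.ε_pos])).deriv_eq]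
    exact mul_pos_of_neg_of_neg (d.g_deriv_neg s (by linarith [d.ε_pos]))
      (d.deriv_H₁_neg ⟨d.tL_lt_b.le.trans hsb, by linarith [hs.2, d.ε_pos]⟩)

/-! ### The rise as a height graph (used by the finger move of `Kᵢ`) -/

/-- **Before the tip time the track is the graph `x₀ = ρ₁ (height)`**: `X₁ t = ρ₁ (H₁ t)`.
[folklore] -/
theorem X₁_eq_ρ₁_H₁ {t : ℝ} (ht : t < d.tD) : d.X₁ t = d.ρ₁ (d.H₁ t) := by
  rw [d.H₁_of_lt_tD ht, ρ₁, X₁, d.Xg_of_le (by linarith [d.tD_lt])]; rfl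

/-- The tip height `h_D = Hh t_D`; there `ρ̃ h_D = x_D`. [folklore] -/
theorem ρt_Hh_tD : d.ρt (d.Hh d.tD) = d.xD := d.Xl_tD

end K2LiteData

end Literature.Topology.FourManifolds
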